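import Literature.Probability.Percolation.KhSThreeDisorderObservable
import Literature.Probability.Percolation.TriSepEscape
import Literature.Probability.Percolation.KhSThreeDisorderBoundaryValues
import Literature.Probability.Percolation.FiveMarkedLoopSpace
import HarnessLib

/-!
# Discrete holomorphicity of `k`-disorder observables for ANY number of marks: the re-linking law, non-crossing of link
# patterns, Khristoforov–Smirnov's Lemma 4 under the tripod law, and the fan observable

Topic `Literature/Probability/Percolation`; generic-`k` layer of the three-disorder lineage (Khristoforov–Smirnov 2021). For a
`k`-marked discrete domain `D : TriMarkedDomain k` (Bollobás–Riordan), the loop configurations with disorders at the `k` corner faces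
and at a mid-edge `z` (the tree's XOR spaces `TXb`, both halves of the subdivided edge) carry a LINK PATTERN: the partner `u_j` of
`z` and the pairing of the other corners («IP(ξ) is a union of disjoint paths, matching marked points», §1.2 p. 2). Khristoforov–Smirnov's
Lemma 4 (§2 p. 4, `k = 3`) groups the configurations at a vertex `v` in triples (the tree's CORES, `KhSThreeDisorderObservable.lean`,
generic in `k`: HT1 core decomposition `hbK_regroup`, HT2 invariant triples `invariantTriplesX_holds`); the only inputs of the proof
that the tree types at `k = 3` alone are PLANAR: the chirality of re-linking cores (`ReLinking₃`) and — implicitly — that link patterns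
do not cross. This file supplies both for every `k` and assembles the generic Lemma 4:

* **Part I — ★ the re-linking law `reLinkingK_holds : ReLinkingK D`**: in a core at a face `v` with three `H_G`-sides whose three
  neighbours are odd and pairwise unlinked, `oppFace v i` being linked to the corner `y_{p i}`, the triple `(p 0, p 1, p 2)` is
  ANTICLOCKWISE (`CcwTriple`: cyclically increasing in `Fin k`). Proof: cut the three strands out (`keepOn`), re-mark `D` at the three
  partner corners (`exists_remark₃_of_strictMono` over the tree's `TriMarkedDomain.remark`), apply the tree's `reLinking₃_holds`.
* **Part II — ★ link patterns are non-crossing `false_of_interleaved_links`**: in a configuration of `H_G` with all side counts `≤ 2`,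
  four ODD corners `y_a, y_b, y_c, y_d` in anticlockwise order (`CcwQuad`) are never linked as `a ~ c`, `b ~ d` (given any fifth mark).
  Proof: cut the two strands out, re-mark at five marks (`exists_remark₅_of_strictMono`), land in the tree's four-corner loop space
  `FivePoint.loopSpace D₅ r`, invoke `loopSurj_holds` + `fiveMarkedLoopLemma_holds` (pattern `A` or `B`) and `odd_component`.
* **Part III — ★★ `holomorphicW_of_tripodLaw`**: for a CLASS WEIGHT `wt j L` (partner `j`, link relation `L` among the corners:
  `linkRel`), the observable `ObsW wt v i = Σ_ξ wt (partner ξ) (linkRel ξ)` over both halves of the XOR space at the `i`-th side of `v`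
  satisfies `Σ_{i : Fin 3} τ^i ObsW wt v i = 0` at every face with three `H_G`-sides of every `k`-marked domain, PROVIDED `wt` obeys the
  TRIPOD LAW: `wt α (L₀+βγ) + τ·wt β (L₀+γα) + τ²·wt γ (L₀+αβ) = 0` for every TRIPOD PICTURE (`TripodPicture`: an anticlockwise triple
  `α, β, γ` and a symmetric, irreflexive relation `L₀` on the other corners, perfect on them, PLANAR together with the chords `αβ, βγ, γα`).
  Ingredients: the link relation of the completions of a core (`reach_attach`, `linkRel_coreCompl_of_inv`, `linkRel_coreCompl_relink`),
  and `tripodPicture_of_core` (anticlockwise by Part I, perfect by the path structure, planar by Part II applied to the core and to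
  its completions). At `k = 3` every picture has `L₀ = ∅`, the weight `j ↦ τ^j` obeys the law (`tripodLaw_tau_pow`), `ObsW` is
  `Σ_j τ^j N_j(z)` (`obsW_tau_pow_eq`) and the theorem is Khristoforov–Smirnov's Lemma 4 (`khsLemma4_of_tripodLaw`, a second proof of the
  tree's `khsLemma4_holds`).
* **Part IV — ★★★ the FAN OBSERVABLE `holomorphicW_fan`**: for `k = 2l+1` marks an EXPLICIT class weight obeying the tripod law
  (`tripodLaw_fan`): weight `−(−τ²)^m` on the FAN PATTERN with apex `m ≤ l` (partner `u_m`; the other corners matched as `{i, 2l−i}`,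
  `i < m`, and `{i, 2l+1−i}`, `m < i ≤ l` — `fanRel`), zero elsewhere (`fanWt`). The only tripod pictures meeting its support are
  `(m, m+1, 2l−m; P_m ∖ {m+1, 2l−m})`, where the law reads `c_m + τ c_{m+1} = 0`; every other candidate is excluded by planarity or by
  the anticlockwise order (`fan_main`). Hence the `(l+1)`-term fan observable is discretely holomorphic on every `(2l+1)`-marked domain:
  at `k = 3` it lies in the span of Khristoforov–Smirnov's `F` and `1`, at `k = 5` it is the lane's sparse five-point observable (up to the
  factor `−τ²`), for `k ≥ 7` it is new (the lane's exact table: its `k` rotations are linearly independent, `k ≤ 13`).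

Status in print: Lemma 4 is printed and tree-typed at `k = 3`; §1.2 sets up `k` disorders and §1 (p. 1) announces generalisations
(«formulae for the probabilities of the link patterns», [tmpKK] in preparation). The `k`-mark statements here are the lane's (first
kernel text): the planar inputs for every `k` by reduction to the tree's `k = 3` and `k = 4`-corner theorems (no new topology), and the
class-weighted Lemma 4 as the implication “tripod law ⇒ discrete holomorphicity”. Which weights obey the tripod law is a finite linear
problem per `k` (the lane's exact table: the solution space has dimension `2, 5, 14, 42` for `k = 3, 5, 7, 9`); at `k = 5` the lane's five
sparse observables (`FivePointHolomorphy*.lean`) are solutions, and Part IV gives one explicit solution (with its rotations) for every odd `k`.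

## References
* M. Khristoforov, S. Smirnov, *Percolation and O(1) loop model*, arXiv:2111.15612 (2021), §1.2 (arXiv v1 p. 2: loop configurations
  with `k` disorders, «IP(ξ) is a union of disjoint paths, matching marked points», counterclockwise cyclic indexing; Lemma 2 pp. 2–3:
  «two possible link patterns»), §2 Definition 3, Lemma 4 with its proof and Fig. 3 (p. 4), Remark 6 (p. 5).
* B. Bollobás, O. Riordan, *Percolation*, Cambridge University Press (2006), Ch. 7 §7.2.2 (pp. 191–195: marked discrete domains,
  Lemma 5), §7.2.3 p. 197 (re-marking «by relabelling»).

## Mathlib / tree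
Tree: `KhSThreeDisorderObservable.lean` (`AllSides`, `Eminus`, `IsCoreb`, `ParityIs`, `TXb`, `InClassX`, `ComplClassX`, `coreSetb`,
`hbK_regroup`, `hbK_compl_mem`, `hbK_complClass_existsUnique`, `invariantTriplesX_holds`, `hbK_core_partners`, `hbK_blind`, `hbK_odd_yc`,
`hbK_yc_ne_v`, `hcK_yc_not_img`, `hcK_partner_blind`, `ReLinking₃`, `reLinking₃_holds`, `KhSLemma4`, `classCount`, `Fobs`, `Gk`,
`sum_tau_classCount_eq`), `KhSThreeDisorderBoundaryValues.lean` (`xiDeg_le_two_of_mem_TXb`), `MarkedLoopSpace.lean` (`odd_component`,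
`touching_of_reachable`, `eq_or_eq_of_inc_three`, `mem_touching_of_side_mem`, `exists_side_not_mem_hBonds_of_corner`, `corners`, `yc`,
`IsCornerFace`, `predDart`), `FiveMarkedLoopSpace.lean` / `FiveMarkedLoopLemma.lean` (`FivePoint.loopSpace`, `loopSurj_holds`,
`xiLinked_xiOf_iff`, `fiveMarkedLoopLemma_holds`, `MatchA`, `MatchB`), `FivePointNormalisation.lean` (`N5.sideGraph`,
`xiLinked_iff_reachable`), `FivePointHolomorphyFaces.lean` (`N5.coreCompl`, `coreEnd`), `TriSepEscape.lean` (`TriMarkedDomain.remark`,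
`remark_iter`, `remark_pos`, `markable_pos`). Mathlib: `Finset.orderEmbOfFin`, `Finset.range_orderEmbOfFin`,
`Finite.surjective_of_injective`, `Fin.strictMono_iff_lt_succ`, `IsPrimitiveRoot.geom_sum_eq_zero`.
-/

open Finset

namespace Literature.Probability.Percolation.MarkedLoops

open Literature.Probability.Percolation Literature.Probability.LatticeModels
open Literature.Probability.Percolation.FivePoint (side xiDeg XiLinked Inc inc_side oppFace_injective')
open Literature.Probability.Percolation.FivePoint.N5 (sideGraph side_oppFace_oppIdx xiLinked_iff_reachable)
open TriMarkedDomain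

/-! ### Keeping the components of a set of faces -/

section Keep

variable {nm : ℕ} (D : TriMarkedDomain nm)

open Classical in
/-- **keeping the components of the faces of `S`**: the sides of `ξ` lying on a face reachable (in the side graph of `ξ`) from a face
of `S`. [cite: KhristoforovSmirnov2021, §1.2 (arXiv v1 p. 2: «IP(ξ) … the union of connectivity components»)] -/
noncomputable def keepOn (ξ : Finset (Sym2 (Site 2))) (S : Finset HexVertex) : Finset (Sym2 (Site 2)) :=
  ξ.filter fun e => ∃ F, (∃ s ∈ S, (sideGraph ξ).Reachable s F) ∧ ∃ j : Fin 3, e = side F j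

variable {D}

/-- the kept predicate is closed under `ξ`-adjacency. [folklore] -/
private theorem keepOn_of_adj {ξ : Finset (Sym2 (Site 2))} {S : Finset HexVertex} {F F' : HexVertex}
    (hP : ∃ s ∈ S, (sideGraph ξ).Reachable s F) (h : (sideGraph ξ).Adj F F') :
    ∃ s ∈ S, (sideGraph ξ).Reachable s F' := by
  obtain ⟨s, hs, h1⟩ := hP
  exact ⟨s, hs, h1.trans ⟨SimpleGraph.Walk.cons h SimpleGraph.Walk.nil⟩⟩

/-- `keepOn ξ S ⊆ ξ`. [cite: KhristoforovSmirnov2021, §1.2 (arXiv v1 p. 2)] -/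
theorem keepOn_subset (ξ : Finset (Sym2 (Site 2))) (S : Finset HexVertex) : keepOn ξ S ⊆ ξ := by
  classical
  exact Finset.filter_subset _ _

/-- on a kept face the side count is unchanged. [cite: KhristoforovSmirnov2021, §1.2 (arXiv v1 p. 2)] -/
theorem xiDeg_keepOn_of_mem {ξ : Finset (Sym2 (Site 2))} {S : Finset HexVertex} {F : HexVertex}
    (hP : ∃ s ∈ S, (sideGraph ξ).Reachable s F) : xiDeg (keepOn ξ S) F = xiDeg ξ F := by
  classical
  unfold xiDeg keepOn
  congr 1
  refine Finset.filter_congr fun j _ => ?_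
  rw [Finset.mem_filter]
  constructor
  · exact fun h => h.1
  · exact fun h => ⟨h, F, hP, j, rfl⟩

/-- off the kept faces the side count vanishes (a kept side of `F` would be a side of a kept face sharing that bond, i.e. of `F` itself or
of the face across — which is then `ξ`-adjacent to `F`). [cite: KhristoforovSmirnov2021, §1.2 (arXiv v1 p. 2)] -/
theorem xiDeg_keepOn_of_not_mem {ξ : Finset (Sym2 (Site 2))} (hξ : ξ ⊆ hBonds D) {S : Finset HexVertex} {F : HexVertex}
    (hP : ¬ ∃ s ∈ S, (sideGraph ξ).Reachable s F) : xiDeg (keepOn ξ S) F = 0 := by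
  classical
  unfold xiDeg
  rw [Finset.card_eq_zero, Finset.filter_eq_empty_iff]
  intro j _ hj
  change side F j ∈ keepOn ξ S at hj
  unfold keepOn at hj
  rw [Finset.mem_filter] at hj
  obtain ⟨hmem, F'', hP'', j'', he⟩ := hj
  have heB : side F j ∈ hBonds D := hξ hmem
  have h1 : F ∈ triFacesTouching D.verts := mem_touching_of_side_mem D heB
  have h2 : oppFace F j ∈ triFacesTouching D.verts :=
    mem_touching_of_side_mem D (j := oppIdx F j) (by rw [side_oppFace_oppIdx]; exact heB)
  have h3 : F'' ∈ triFacesTouching D.verts := mem_touching_of_side_mem D (j := j'') (by rw [← he]; exact heB)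
  rcases eq_or_eq_of_inc_three D heB h1 h2 h3 (inc_side F j) (by rw [← side_oppFace_oppIdx F j]; exact inc_side _ _)
      (by rw [he]; exact inc_side _ _) (fun e => (hexGraph_adj_oppFace F j).ne e) with rfl | rfl
  · exact hP hP''
  · exact hP (keepOn_of_adj hP'' ⟨oppIdx F j, by rw [oppFace_oppFace], by rw [side_oppFace_oppIdx]; exact hmem⟩)

/-- linking from a kept face survives the restriction. [cite: KhristoforovSmirnov2021, §1.2 (arXiv v1 p. 2)] -/
theorem xiLinked_keepOn {ξ : Finset (Sym2 (Site 2))} {S : Finset HexVertex} {Y Y' : HexVertex}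
    (hY : ∃ s ∈ S, (sideGraph ξ).Reachable s Y) (h : XiLinked ξ Y Y') : XiLinked (keepOn ξ S) Y Y' := by
  classical
  unfold XiLinked at h ⊢
  induction h with
  | refl => exact Relation.ReflTransGen.refl
  | @tail b c hab hbc ih =>
    obtain ⟨j, hc, hmem⟩ := hbc
    have hb : ∃ s ∈ S, (sideGraph ξ).Reachable s b := by
      have hYb : (sideGraph ξ).Reachable Y b := (xiLinked_iff_reachable ξ Y b).1 hab
      obtain ⟨s, hs, h1⟩ := hY
      exact ⟨s, hs, h1.trans hYb⟩
    refine ih.tail ⟨j, hc, ?_⟩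
    unfold keepOn
    rw [Finset.mem_filter]
    exact ⟨hmem, b, hb, j, rfl⟩

/-- linking in a sub-configuration is linking. [cite: KhristoforovSmirnov2021, §1.2 (arXiv v1 p. 2)] -/
theorem xiLinked_mono {ξ ξ' : Finset (Sym2 (Site 2))} (hsub : ξ' ⊆ ξ) {Y Y' : HexVertex} (h : XiLinked ξ' Y Y') :
    XiLinked ξ Y Y' := by
  unfold XiLinked at h ⊢
  induction h with
  | refl => exact Relation.ReflTransGen.refl
  | tail _ hbc ih =>
    obtain ⟨j, hc, hm⟩ := hbc
    exact ih.tail ⟨j, hc, hsub hm⟩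

/-- a face with no side in `ξ` reaches only itself. [folklore] -/
private theorem eq_of_reachable_of_xiDeg_eq_zero {ξ : Finset (Sym2 (Site 2))} {F F' : HexVertex} (h0 : xiDeg ξ F = 0)
    (h : (sideGraph ξ).Reachable F F') : F' = F := by
  classical
  obtain ⟨w⟩ := h
  cases w with
  | nil => rfl
  | cons hadj _ =>
    exfalso
    obtain ⟨j, -, hj⟩ := hadj
    unfold xiDeg at h0
    rw [Finset.card_eq_zero, Finset.filter_eq_empty_iff] at h0
    exact h0 (Finset.mem_univ j) hj

end Keep

/-! ### A 3-marked re-marking at three of the marks -/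

section Remark

variable {nm : ℕ} (D : TriMarkedDomain nm)

/-- two marked domains on the same sites have the same `H_G`. [cite: KhristoforovSmirnov2021, §1.2 (arXiv v1 p. 2)] -/
theorem hBonds_eq_of_verts_eq' {k' : ℕ} {D' : TriMarkedDomain k'} (hV : D'.verts = D.verts) : hBonds D' = hBonds D := by
  unfold hBonds; rw [hV]

/-- **re-marking at three marks**: for three marks `c 0 < c 1 < c 2` of `D` there is a 3-marked domain on the same sites whose corner faces
are `y_{c 0}, y_{c 1}, y_{c 2}` (Bollobás–Riordan's relabelling; the tree's `TriMarkedDomain.remark` at the old mark positions).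
[cite: BollobasRiordan2006, Ch. 7 §7.2.3 p. 197 («or by relabelling»); §7.2.2 pp. 191–193 (marked domains)] -/
theorem exists_remark₃_of_strictMono (c : Fin 3 → Fin nm) (hc : StrictMono c) :
    ∃ D₃ : TriMarkedDomain 3, D₃.verts = D.verts ∧ ∀ t, yc D₃ t = yc D (c t) := by
  classical
  set m : Fin 3 → ℕ := fun t => D.pos (c t) with hm_def
  have hm : StrictMono m := fun a b hab => D.pos_strictMono (hc hab)
  have h0t : ∀ t, m 0 ≤ m t := fun t => hm.monotone (Fin.zero_le t)
  have hL : ∀ t, m t < m 0 + #(triBdryDarts D.verts) := fun t =>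
    lt_of_lt_of_le (D.pos_lt (c t)) (Nat.le_add_left _ _)
  have hmk : ∀ t, D.Markable (m t) := fun t => D.markable_pos (c t)
  have hinj : Function.Injective fun t => (triBdryIter D.verts D.base (m t)).1 := by
    intro t t' h
    exact hc.injective (D.mark_injective h)
  refine ⟨D.remark m hm hL hmk hinj, rfl, fun t => ?_⟩
  symm
  apply eq_yc
  have hY := yc_spec D (c t)
  unfold IsCornerFace at hY ⊢
  rw [hY]
  have e1 : (D.remark m hm hL hmk hinj).markDart t = D.markDart (c t) := by
    show triBdryIter (D.remark m hm hL hmk hinj).verts (D.remark m hm hL hmk hinj).base ((D.remark m hm hL hmk hinj).pos t) = _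
    rw [remark_iter, remark_pos, Nat.add_sub_cancel' (h0t t)]
    rfl
  have e2 : (D.remark m hm hL hmk hinj).markSite t = D.markSite (c t) := by
    unfold markSite; rw [e1]
  have e3 : predDart (D.remark m hm hL hmk hinj) t = predDart D (c t) := by
    unfold predDart
    show triBdryIter (D.remark m hm hL hmk hinj).verts (D.remark m hm hL hmk hinj).base _ = _
    rw [remark_iter, remark_pos]
    unfold TriMarkedDomain.bdryLen
    rw [remark_verts, ← add_assoc, Nat.add_sub_cancel' (h0t t)]
  rw [e1, e2, e3]

end Remark

/-! ### Cores: elementary facts (generic `k`) -/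

section CoreFacts

variable {nm : ℕ} {D : TriMarkedDomain nm} {v : HexVertex} (hv : AllSides D v) {ζ : Finset (Sym2 (Site 2))}
  (hq : IsCoreb D v Finset.univ ζ)
include hq

/-- a core lies in `H_G`. [cite: KhristoforovSmirnov2021, §2 Lemma 4 (p. 4), proof and Fig. 3] -/
theorem core_subset_hBonds : ζ ⊆ hBonds D := fun b hb => by
  have h := hq.1 hb
  unfold Eminus at h
  exact (Finset.mem_filter.1 h).1

/-- a core avoids the sides of `v`. [cite: KhristoforovSmirnov2021, §2 Lemma 4 (p. 4), proof and Fig. 3] -/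
theorem side_not_mem_core (j : Fin 3) : side v j ∉ ζ := fun hb => by
  have h := hq.1 hb
  unfold Eminus at h
  exact (Finset.mem_filter.1 h).2 j rfl

include hv

omit hq in
/-- the neighbours of `v` touch `G`. [cite: KhristoforovSmirnov2021, §2 Lemma 4 (p. 4)] -/
private theorem oppFace_mem_touching (i : Fin 3) : oppFace v i ∈ triFacesTouching D.verts :=
  mem_touching_of_side_mem D (j := oppIdx v i) (by rw [side_oppFace_oppIdx]; exact hv i)

omit hv in
/-- **all side counts of a core are at most two** (a face with three sides in `ζ` would be odd, hence a neighbour of `v` — whose side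
towards `v` is not in `ζ` — or a corner face — which has a side off `H_G`). [cite: KhristoforovSmirnov2021, §2 Lemma 4 (p. 4), proof and Fig. 3] -/
theorem core_xiDeg_le_two (F : HexVertex) : xiDeg ζ F ≤ 2 := by
  classical
  by_contra h3
  have hle3 : xiDeg ζ F ≤ 3 := by
    unfold xiDeg; exact (Finset.card_filter_le _ _).trans (by simp)
  have he3 : xiDeg ζ F = 3 := by omega
  -- all three sides of `F` are in `ζ`
  have hall : ∀ j : Fin 3, side F j ∈ ζ := by
    intro j
    unfold xiDeg at he3
    have hfull : (Finset.univ : Finset (Fin 3)).filter (fun j => s(faceVertex F (j + 1), faceVertex F (j + 2)) ∈ ζ) = Finset.univ :=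
      Finset.eq_univ_of_card _ (by rw [he3]; simp)
    have := Finset.mem_univ j
    rw [← hfull, Finset.mem_filter] at this
    exact this.2
  have hFt : F ∈ triFacesTouching D.verts := mem_touching_of_side_mem D (core_subset_hBonds hq (hall 0))
  have hodd : Odd (xiDeg ζ F) := by rw [he3]; exact ⟨1, rfl⟩
  have hmem := (hq.2.2 F hFt).1 hodd
  rcases Finset.mem_symmDiff.1 hmem with ⟨hc, -⟩ | ⟨hN, -⟩
  · obtain ⟨a, rfl⟩ := (mem_corners D).1 hc
    obtain ⟨j, hj⟩ := exists_side_not_mem_hBonds_of_corner D (yc_spec D a)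
    exact hj (core_subset_hBonds hq (hall j))
  · obtain ⟨i, -, rfl⟩ := Finset.mem_image.1 hN
    have := hall (oppIdx v i)
    rw [side_oppFace_oppIdx] at this
    exact side_not_mem_core hq i this

/-- **a neighbour of `v` which is a corner face has no side in the core** (its side towards `v` is excluded, one side is off `H_G`, and
its side count is even). [cite: KhristoforovSmirnov2021, §2 Lemma 4 (p. 4), proof and Fig. 3] -/
theorem xiDeg_eq_zero_of_corner_nbr {i : Fin 3} (hc : oppFace v i ∈ corners D) : xiDeg ζ (oppFace v i) = 0 := by
  classical
  obtain ⟨a, ha⟩ := (mem_corners D).1 hc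
  obtain ⟨j₂, hj₂⟩ := exists_side_not_mem_hBonds_of_corner D ((isCornerFace_iff_eq_yc D).2 ha)
  have hj₁ : side (oppFace v i) (oppIdx v i) ∉ ζ := by rw [side_oppFace_oppIdx]; exact side_not_mem_core hq i
  have hj₂' : side (oppFace v i) j₂ ∉ ζ := fun h => hj₂ (core_subset_hBonds hq h)
  have hne : oppIdx v i ≠ j₂ := by
    intro e
    apply hj₂
    rw [← e, side_oppFace_oppIdx]
    exact hv i
  -- the side count is at most one …
  have hle : xiDeg ζ (oppFace v i) ≤ 1 := by
    unfold xiDeg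
    have hsub : (Finset.univ : Finset (Fin 3)).filter (fun j => s(faceVertex (oppFace v i) (j + 1), faceVertex (oppFace v i) (j + 2)) ∈ ζ)
        ⊆ (Finset.univ.erase (oppIdx v i)).erase j₂ := by
      intro j hj
      rw [Finset.mem_filter] at hj
      rw [Finset.mem_erase, Finset.mem_erase]
      refine ⟨fun e => hj₂' (e ▸ hj.2), fun e => hj₁ (e ▸ hj.2), Finset.mem_univ _⟩
    refine (Finset.card_le_card hsub).trans ?_
    rw [Finset.card_erase_of_mem (Finset.mem_erase.2 ⟨hne.symm, Finset.mem_univ _⟩), Finset.card_erase_of_mem (Finset.mem_univ _)]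
    simp
  -- … and even
  have heven : ¬ Odd (xiDeg ζ (oppFace v i)) := by
    intro ho
    have := (hq.2.2 _ (oppFace_mem_touching hv i)).1 ho
    rw [Finset.mem_symmDiff] at this
    rcases this with ⟨-, hN⟩ | ⟨-, hc'⟩
    · exact hN (Finset.mem_image.2 ⟨i, Finset.mem_univ _, rfl⟩)
    · exact hc' hc
  rcases Nat.even_or_odd (xiDeg ζ (oppFace v i)) with ⟨m, hm⟩ | ho
  · omega
  · exact absurd ho heven

/-- a neighbour of `v` which is not a corner face is odd. [cite: KhristoforovSmirnov2021, §2 Lemma 4 (p. 4), proof and Fig. 3] -/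
theorem odd_xiDeg_of_not_corner_nbr {i : Fin 3} (hc : oppFace v i ∉ corners D) : Odd (xiDeg ζ (oppFace v i)) :=
  (hq.2.2 _ (oppFace_mem_touching hv i)).2 (Finset.mem_symmDiff.2 (Or.inr ⟨Finset.mem_image.2 ⟨i, Finset.mem_univ _, rfl⟩, hc⟩))

/-- **the partner of a neighbour is determined**: a corner reached from the neighbour `oppFace v i` is its partner `y_{p i}`.
[cite: KhristoforovSmirnov2021, §2 Lemma 4 (p. 4), proof and Fig. 3] -/
theorem partner_unique {i : Fin 3} {a b : Fin nm} (ha : (sideGraph ζ).Reachable (oppFace v i) (yc D a))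
    (hb : (sideGraph ζ).Reachable (oppFace v i) (yc D b)) : a = b := by
  classical
  by_cases hc : oppFace v i ∈ corners D
  · have h0 := xiDeg_eq_zero_of_corner_nbr hv hq hc
    have ea := eq_of_reachable_of_xiDeg_eq_zero h0 ha
    have eb := eq_of_reachable_of_xiDeg_eq_zero h0 hb
    exact yc_injective D (ea.trans eb.symm)
  · have hna := hcK_yc_not_img hv hq hc ha
    have hnb := hcK_yc_not_img hv hq hc hb
    have oa : Odd (xiDeg ζ (yc D a)) := hbK_odd_yc hq a hna
    have ob : Odd (xiDeg ζ (yc D b)) := hbK_odd_yc hq b hnb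
    have na : yc D a ≠ oppFace v i := fun e => hna i (Finset.mem_univ _) e.symm
    have nb : yc D b ≠ oppFace v i := fun e => hnb i (Finset.mem_univ _) e.symm
    have := (odd_component D (core_subset_hBonds hq) (core_xiDeg_le_two hq) (oppFace_mem_touching hv i)
      (odd_xiDeg_of_not_corner_nbr hv hq hc)).2 _ _ ha hb oa ob na nb
    exact yc_injective D this

omit hv hq in
/-- **the partners of pairwise unlinked neighbours are distinct.** [cite: KhristoforovSmirnov2021, §2 Lemma 4 (p. 4), proof and Fig. 3] -/
theorem partners_injective (hnl : ∀ i i' : Fin 3, i ≠ i' → ¬ XiLinked ζ (oppFace v i) (oppFace v i'))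
    {p : Fin 3 → Fin nm} (hp : ∀ i : Fin 3, XiLinked ζ (oppFace v i) (yc D (p i))) : Function.Injective p := by
  intro i i' h
  by_contra hne
  apply hnl i i' hne
  rw [xiLinked_iff_reachable] at *
  have h1 := (xiLinked_iff_reachable _ _ _).1 (hp i)
  have h2 := (xiLinked_iff_reachable _ _ _).1 (hp i')
  rw [h] at h1
  exact h1.trans h2.symm

end CoreFacts

/-! ### The re-linking law for `k` marks -/

section ReLinking

variable {nm : ℕ} (D : TriMarkedDomain nm)

/-- **an anticlockwise triple of marks**: `(a, b, c)` is cyclically increasing — the marks of `D` are indexed in anticlockwise order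
(`pos_strictMono`), so this says that `y_a, y_b, y_c` lie in this anticlockwise order on `∂Ω`.
[cite: KhristoforovSmirnov2021, §1.2 (arXiv v1 p. 2: marked points «go in the counterclockwise order and are indexed cyclically»)] -/
def CcwTriple (a b c : Fin nm) : Prop := (a < b ∧ b < c) ∨ (b < c ∧ c < a) ∨ (c < a ∧ a < b)

/-- **HT3 (RE-LINKING TRIPLES) for `k` marks**: in a core at a vertex with three `H_G`-sides whose three neighbours are odd and pairwise
unlinked, the neighbour `oppFace v i` being linked to the corner `y_{p i}`, the triple `(p 0, p 1, p 2)` is anticlockwise.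
[cite: KhristoforovSmirnov2021, §2 Lemma 4, proof and Fig. 3 (p. 4: the re-linking row of triples)] -/
def ReLinkingK (D : TriMarkedDomain nm) : Prop :=
  ∀ v : HexVertex, AllSides D v → ∀ ζ : Finset (Sym2 (Site 2)), IsCoreb D v Finset.univ ζ →
    (∀ i i' : Fin 3, i ≠ i' → ¬ XiLinked ζ (oppFace v i) (oppFace v i')) →
    ∀ p : Fin 3 → Fin nm, (∀ i : Fin 3, XiLinked ζ (oppFace v i) (yc D (p i))) → CcwTriple (p 0) (p 1) (p 2)

/-- Auxiliary. [folklore] -/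
private theorem fin3_cases_d (d : Fin 3) : d = 0 ∨ d = 1 ∨ d = 2 := by
  revert d; decide

/-- a rotation of an increasing triple is an anticlockwise triple. [cite: KhristoforovSmirnov2021, §1.2 (arXiv v1 p. 2: marked points in the counterclockwise order, indexed cyclically)] -/
theorem ccwTriple_of_rotation {c : Fin 3 → Fin nm} (hc : StrictMono c) {p : Fin 3 → Fin nm} {d : Fin 3}
    (h : ∀ i : Fin 3, p i = c (i + d)) : CcwTriple (p 0) (p 1) (p 2) := by
  have h01 : c 0 < c 1 := hc (by decide)
  have h12 : c 1 < c 2 := hc (by decide)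
  unfold CcwTriple
  rcases fin3_cases_d d with rfl | rfl | rfl
  · left
    rw [h 0, h 1, h 2]
    exact ⟨by simpa using h01, by simpa using h12⟩
  · right; right
    rw [h 0, h 1, h 2]
    refine ⟨?_, ?_⟩
    · show c (2 + 1) < c (0 + 1)
      rw [show (2 : Fin 3) + 1 = 0 from by decide, show (0 : Fin 3) + 1 = 1 from by decide]; exact h01
    · show c (0 + 1) < c (1 + 1)
      rw [show (0 : Fin 3) + 1 = 1 from by decide, show (1 : Fin 3) + 1 = 2 from by decide]; exact h12
  · right; left
    rw [h 0, h 1, h 2]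
    refine ⟨?_, ?_⟩
    · show c (1 + 2) < c (2 + 2)
      rw [show (1 : Fin 3) + 2 = 0 from by decide, show (2 : Fin 3) + 2 = 1 from by decide]; exact h01
    · show c (2 + 2) < c (0 + 2)
      rw [show (2 : Fin 3) + 2 = 1 from by decide, show (0 : Fin 3) + 2 = 2 from by decide]; exact h12

/-- ★★ **THE RE-LINKING LAW FOR EVERY NUMBER OF MARKS**: the three strands of a re-linking core meet the corners in anticlockwise order.
Proof: cut out the three strands (`keepOn`), re-mark `D` at the three partner corners in increasing order (`exists_remark₃_of_strictMono`)
— the cut configuration is a re-linking core of the re-marked 3-marked domain at the same vertex — and apply the tree's `k = 3` law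
`reLinking₃_holds`. [cite: KhristoforovSmirnov2021, §2 Lemma 4, proof and Fig. 3 (p. 4); §1.2 (p. 2)] -/
theorem reLinkingK_holds : ReLinkingK D := by
  classical
  intro v hv ζ hq hnl p hp
  have hp' : ∀ i : Fin 3, (sideGraph ζ).Reachable (oppFace v i) (yc D (p i)) := fun i => (xiLinked_iff_reachable _ _ _).1 (hp i)
  have hinj : Function.Injective p := partners_injective hnl hp
  -- the three partner corners in increasing order
  set s : Finset (Fin nm) := Finset.univ.image p with hs_def
  have hs : s.card = 3 := by rw [hs_def, Finset.card_image_of_injective _ hinj]; simp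
  set c : Fin 3 → Fin nm := fun t => s.orderEmbOfFin hs t with hc_def
  have hc : StrictMono c := fun a b hab => (s.orderEmbOfFin hs).strictMono hab
  have hcmem : ∀ i, ∃ t, c t = p i := by
    intro i
    have : p i ∈ Set.range (s.orderEmbOfFin hs) := by
      rw [Finset.range_orderEmbOfFin, Finset.mem_coe, hs_def]
      exact Finset.mem_image.2 ⟨i, Finset.mem_univ _, rfl⟩
    obtain ⟨t, ht⟩ := this
    exact ⟨t, ht⟩
  choose σ hσ using hcmem
  have hσinj : Function.Injective σ := fun i i' h => hinj (by rw [← hσ i, ← hσ i', h])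
  have hσsurj : Function.Surjective σ := Finite.surjective_of_injective hσinj
  -- the re-marked 3-marked domain
  obtain ⟨D₃, hV, hyc⟩ := exists_remark₃_of_strictMono D c hc
  have hB : hBonds D₃ = hBonds D := hBonds_eq_of_verts_eq' D hV
  have hv₃ : AllSides D₃ v := fun j => by rw [hB]; exact hv j
  have hyc' : ∀ i, yc D₃ (σ i) = yc D (p i) := fun i => by rw [hyc, hσ]
  -- the cut configuration: the components of the three neighbours
  set N : Finset HexVertex := Finset.univ.image (oppFace v) with hN_def
  set ζ' := keepOn ζ N with hζ'_def
  have hζh : ζ ⊆ hBonds D := core_subset_hBonds hq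
  have hdeg := core_xiDeg_le_two hq
  have hmemN : ∀ {F}, F ∈ N ↔ ∃ i, F = oppFace v i := by
    intro F
    rw [hN_def, Finset.mem_image]
    constructor
    · rintro ⟨i, -, h⟩; exact ⟨i, h.symm⟩
    · rintro ⟨i, h⟩; exact ⟨i, Finset.mem_univ _, h.symm⟩
  have hreachN : ∀ i, ∃ s ∈ N, (sideGraph ζ).Reachable s (oppFace v i) :=
    fun i => ⟨oppFace v i, hmemN.2 ⟨i, rfl⟩, SimpleGraph.Reachable.refl _⟩
  -- corners of `D₃` are corners of `D`
  have hC3sub : ∀ {F}, F ∈ corners D₃ → F ∈ corners D := by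
    intro F hF
    obtain ⟨t, rfl⟩ := (mem_corners D₃).1 hF
    rw [hyc]; exact yc_mem_corners D _
  -- KEY: on the components of the neighbours, the corners of `D` are corners of `D₃`
  have key : ∀ F, (∃ s ∈ N, (sideGraph ζ).Reachable s F) → F ∈ corners D → F ∈ corners D₃ := by
    rintro F ⟨s, hs, hsF⟩ hFc
    obtain ⟨i, rfl⟩ := hmemN.1 hs
    by_cases hci : oppFace v i ∈ corners D
    · -- a corner neighbour reaches only itself, and is its own partner
      have h0 := xiDeg_eq_zero_of_corner_nbr hv hq hci
      have eF := eq_of_reachable_of_xiDeg_eq_zero h0 hsF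
      have eP := eq_of_reachable_of_xiDeg_eq_zero h0 (hp' i)
      rw [eF, ← eP, ← hyc' i]
      exact yc_mem_corners D₃ _
    · obtain ⟨a, rfl⟩ := (mem_corners D).1 hFc
      have := partner_unique hv hq hsF (hp' i)
      rw [this, ← hyc' i]
      exact yc_mem_corners D₃ _
  -- the cut configuration is a re-linking core of `D₃` at `v`
  have hq' : IsCoreb D₃ v Finset.univ ζ' := by
    refine ⟨?_, hq.2.1, ?_⟩
    · intro b hb
      have hbζ : b ∈ ζ := keepOn_subset ζ N hb
      have h := hq.1 hbζ
      unfold Eminus at h ⊢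
      rw [hB]
      exact h
    · intro F hF
      rw [hV] at hF
      by_cases hP : ∃ s ∈ N, (sideGraph ζ).Reachable s F
      · rw [hζ'_def, xiDeg_keepOn_of_mem hP, hq.2.2 F hF, Finset.mem_symmDiff, Finset.mem_symmDiff]
        constructor
        · rintro (⟨hc, hn⟩ | ⟨hn, hc⟩)
          · exact Or.inl ⟨key F hP hc, hn⟩
          · exact Or.inr ⟨hn, fun h => hc (hC3sub h)⟩
        · rintro (⟨hc, hn⟩ | ⟨hn, hc⟩)
          · exact Or.inl ⟨hC3sub hc, hn⟩
          · exact Or.inr ⟨hn, fun h => hc (key F hP h)⟩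
      · rw [hζ'_def, xiDeg_keepOn_of_not_mem (D := D) hζh hP, Finset.mem_symmDiff]
        constructor
        · intro h; exact absurd h (by decide)
        · rintro (⟨hc, -⟩ | ⟨hn, -⟩)
          · exfalso
            obtain ⟨t, rfl⟩ := (mem_corners D₃).1 hc
            obtain ⟨i, rfl⟩ := hσsurj t
            exact hP ⟨oppFace v i, hmemN.2 ⟨i, rfl⟩, by rw [hyc' i]; exact hp' i⟩
          · exfalso
            obtain ⟨i, rfl⟩ := hmemN.1 hn
            exact hP (hreachN i)
  have hnl' : ∀ i i' : Fin 3, i ≠ i' → ¬ XiLinked ζ' (oppFace v i) (oppFace v i') :=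
    fun i i' hne h => hnl i i' hne (xiLinked_mono (keepOn_subset ζ N) h)
  have hpσ : ∀ i : Fin 3, XiLinked ζ' (oppFace v i) (yc D₃ (σ i)) := fun i => by
    rw [hyc' i]
    exact xiLinked_keepOn (hreachN i) (hp i)
  -- the `k = 3` law: `σ` is a rotation
  obtain ⟨d, hd⟩ := reLinking₃_holds D₃ v hv₃ ζ' hq' hnl' σ hpσ
  exact ccwTriple_of_rotation hc (d := d) (fun i => by rw [← hσ i, hd i])

end ReLinking

/-! ### Consistency at `k = 3`: `ReLinkingK` is `ReLinking₃` -/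

section Three

/-- at `k = 3`, an anticlockwise triple of marks is a rotation of `(0, 1, 2)`, and conversely. [cite: KhristoforovSmirnov2021, §2 Lemma 4, proof and Fig. 3 (p. 4); §1.2 (p. 2: cyclic indexing)] -/
theorem ccwTriple_iff_rotation (p : Fin 3 → Fin 3) : CcwTriple (p 0) (p 1) (p 2) ↔ ∃ d : Fin 3, ∀ i : Fin 3, p i = i + d := by
  constructor
  · intro h
    unfold CcwTriple at h
    have key : ∀ a b c : Fin 3, ((a < b ∧ b < c) ∨ (b < c ∧ c < a) ∨ (c < a ∧ a < b)) →
        ∃ d : Fin 3, a = 0 + d ∧ b = 1 + d ∧ c = 2 + d := by decide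
    obtain ⟨d, h0, h1, h2⟩ := key _ _ _ h
    refine ⟨d, fun i => ?_⟩
    have : ∀ i : Fin 3, i = 0 ∨ i = 1 ∨ i = 2 := by decide
    rcases this i with rfl | rfl | rfl
    · exact h0
    · exact h1
    · exact h2
  · rintro ⟨d, hd⟩
    have hc : StrictMono (fun t : Fin 3 => t) := fun a b h => h
    exact ccwTriple_of_rotation hc (c := fun t => t) (d := d) (fun i => by rw [hd i])

/-- at `k = 3`, the `k`-mark re-linking law is the tree's `ReLinking₃` (and holds by either route). [cite: KhristoforovSmirnov2021, §2 Lemma 4, proof and Fig. 3 (p. 4)] -/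
theorem reLinkingK_three (D : TriMarkedDomain 3) : ReLinkingK D ↔ ReLinking₃ D := by
  constructor
  · intro h v hv ζ hq hnl p hp
    exact (ccwTriple_iff_rotation p).1 (h v hv ζ hq hnl p hp)
  · intro h v hv ζ hq hnl p hp
    exact (ccwTriple_iff_rotation p).2 (h v hv ζ hq hnl p hp)

end Three


/-! # Part II — LINK PATTERNS ARE NON-CROSSING (every `k`): two strands with interleaved odd corner endpoints do not exist

Tool for the `k`-mark discrete holomorphicity: in a configuration `η ⊆ H_G` with all side counts `≤ 2`, four ODD corner faces
`y_a, y_b, y_c, y_d` in anticlockwise order cannot be linked as `a ~ c`, `b ~ d`. Proof WITHOUT new topology: cut the two strands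
out (`keepOn`), re-mark `D` at FIVE marks `a, b, c, d, e` (`e` any fifth mark; `exists_remark₅_of_strictMono`), so that the cut
configuration lies in the tree's four-corner loop space `FivePoint.loopSpace D₅ r` (`r` = the index of `e`); by the tree's
`loopSurj_holds` it is the loop configuration of a colouring, whose link pattern is `A` or `B` (`fiveMarkedLoopLemma_holds`:
adjacent corners are matched) — a third odd corner in the component of `y'_{r+1}` contradicts `odd_component`. -/

section NonCrossing

variable {nm : ℕ} (D : TriMarkedDomain nm)

/-- **re-marking at five marks** (as `exists_remark₃_of_strictMono`). [cite: BollobasRiordan2006, Ch. 7 §7.2.3 p. 197 («or by relabelling»); §7.2.2 pp. 191–193] -/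
theorem exists_remark₅_of_strictMono (c : Fin 5 → Fin nm) (hc : StrictMono c) :
    ∃ D₅ : TriMarkedDomain 5, D₅.verts = D.verts ∧ ∀ t, yc D₅ t = yc D (c t) := by
  classical
  set m : Fin 5 → ℕ := fun t => D.pos (c t) with hm_def
  have hm : StrictMono m := fun a b hab => D.pos_strictMono (hc hab)
  have h0t : ∀ t, m 0 ≤ m t := fun t => hm.monotone (Fin.zero_le t)
  have hL : ∀ t, m t < m 0 + #(triBdryDarts D.verts) := fun t =>
    lt_of_lt_of_le (D.pos_lt (c t)) (Nat.le_add_left _ _)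
  have hmk : ∀ t, D.Markable (m t) := fun t => D.markable_pos (c t)
  have hinj : Function.Injective fun t => (triBdryIter D.verts D.base (m t)).1 := by
    intro t t' h
    exact hc.injective (D.mark_injective h)
  refine ⟨D.remark m hm hL hmk hinj, rfl, fun t => ?_⟩
  symm
  apply eq_yc
  have hY := yc_spec D (c t)
  unfold IsCornerFace at hY ⊢
  rw [hY]
  have e1 : (D.remark m hm hL hmk hinj).markDart t = D.markDart (c t) := by
    show triBdryIter (D.remark m hm hL hmk hinj).verts (D.remark m hm hL hmk hinj).base ((D.remark m hm hL hmk hinj).pos t) = _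
    rw [remark_iter, remark_pos, Nat.add_sub_cancel' (h0t t)]
    rfl
  have e2 : (D.remark m hm hL hmk hinj).markSite t = D.markSite (c t) := by
    unfold markSite; rw [e1]
  have e3 : predDart (D.remark m hm hL hmk hinj) t = predDart D (c t) := by
    unfold predDart
    show triBdryIter (D.remark m hm hL hmk hinj).verts (D.remark m hm hL hmk hinj).base _ = _
    rw [remark_iter, remark_pos]
    unfold TriMarkedDomain.bdryLen
    rw [remark_verts, ← add_assoc, Nat.add_sub_cancel' (h0t t)]
  rw [e1, e2, e3]

variable {D}

/-- linking is symmetric. [cite: KhristoforovSmirnov2021, §1.2 (arXiv v1 p. 2)] -/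
theorem xiLinked_symm' {ξ : Finset (Sym2 (Site 2))} {Y Y' : HexVertex} (h : XiLinked ξ Y Y') : XiLinked ξ Y' Y := by
  rw [xiLinked_iff_reachable] at h ⊢; exact h.symm

/-- linking is transitive. [cite: KhristoforovSmirnov2021, §1.2 (arXiv v1 p. 2)] -/
theorem xiLinked_trans' {ξ : Finset (Sym2 (Site 2))} {Y Y' Y'' : HexVertex} (h : XiLinked ξ Y Y') (h' : XiLinked ξ Y' Y'') :
    XiLinked ξ Y Y'' := by
  rw [xiLinked_iff_reachable] at h h' ⊢; exact h.trans h'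

/-- side counts are monotone in the configuration. [folklore] -/
private theorem xiDeg_mono {ξ ξ' : Finset (Sym2 (Site 2))} (h : ξ' ⊆ ξ) (F : HexVertex) : xiDeg ξ' F ≤ xiDeg ξ F := by
  classical
  unfold xiDeg
  exact Finset.card_le_card (fun j hj => by
    rw [Finset.mem_filter] at hj ⊢; exact ⟨hj.1, h hj.2⟩)

/-- the tree's `k = 5` objects on the `MarkedLoops` side: same `H_G`, same corner faces. [cite: KhristoforovSmirnov2021, §1.2 (arXiv v1 p. 2)] -/
theorem fivePoint_hBonds_eq (D₅ : TriMarkedDomain 5) : FivePoint.hBonds D₅ = hBonds D₅ := rfl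

/-- Auxiliary. [cite: KhristoforovSmirnov2021, §1.2 (arXiv v1 p. 2)] -/
theorem fivePoint_isCornerFace_iff (D₅ : TriMarkedDomain 5) (i : Fin 5) (F : HexVertex) :
    FivePoint.IsCornerFace D₅ i F ↔ IsCornerFace D₅ i F := Iff.rfl

/-- Auxiliary. [folklore] -/
private theorem fin5_ne_iff (r t : Fin 5) : t ≠ r ↔ (t = r + 1 ∨ t = r + 2 ∨ t = r + 3 ∨ t = r + 4) := by
  revert r t; decide

/-- Auxiliary. [folklore] -/
private theorem fin5_succ_ne (r : Fin 5) : r + 1 ≠ r ∧ r + 2 ≠ r ∧ r + 3 ≠ r ∧ r + 4 ≠ r ∧ r + 1 ≠ r + 2 ∧ r + 1 ≠ r + 3 ∧ r + 1 ≠ r + 4 ∧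
    r + 2 ≠ r + 3 ∧ r + 2 ≠ r + 4 ∧ r + 3 ≠ r + 4 := by
  revert r; decide

/-- Auxiliary. [folklore] -/
private theorem or4_rot {p q r s : Prop} : (p ∨ q ∨ r ∨ s) ↔ (q ∨ r ∨ s ∨ p) := by tauto

/-- **the five-mark core of the non-crossing lemma**: a configuration of `H_G` with all side counts `≤ 2` whose odd touching faces
are exactly the corners `y_{c t}`, `t ≠ r`, of five increasing marks `c 0 < ⋯ < c 4` cannot link `y_{c(r+1)} ~ y_{c(r+3)}` and
`y_{c(r+2)} ~ y_{c(r+4)}` (the crossing pattern): re-marked at the five marks it is the loop configuration of a colouring of the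
4-corner problem with reference `r` (tree `loopSurj_holds`), whose pattern is `A` or `B` (tree `fiveMarkedLoopLemma_holds`).
[cite: KhristoforovSmirnov2021, §1.2 Lemma 2 (arXiv v1 pp. 2–3: «two possible link patterns») ; BollobasRiordan2006, Ch. 7 Lemma 5 pp. 193–195] -/
theorem false_of_crossed_links₅ {η : Finset (Sym2 (Site 2))} (hη : η ⊆ hBonds D) (hdeg : ∀ F, xiDeg η F ≤ 2)
    (c : Fin 5 → Fin nm) (hc : StrictMono c) (r : Fin 5) {x₁ x₂ x₃ x₄ : Fin nm}
    (hx₁ : c (r + 1) = x₁) (hx₂ : c (r + 2) = x₂) (hx₃ : c (r + 3) = x₃) (hx₄ : c (r + 4) = x₄)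
    (hpar : ∀ F ∈ triFacesTouching D.verts, Odd (xiDeg η F) ↔ (F = yc D x₁ ∨ F = yc D x₂ ∨ F = yc D x₃ ∨ F = yc D x₄))
    (h13 : XiLinked η (yc D x₁) (yc D x₃)) : False := by
  classical
  subst hx₁ hx₂ hx₃ hx₄
  obtain ⟨D₅, hV, hyc⟩ := exists_remark₅_of_strictMono D c hc
  obtain ⟨n1, n2, n3, n4, n12, n13, n14, n23, n24, n34⟩ := fin5_succ_ne r
  -- membership in the tree's four-corner loop space of `D₅` with reference `r`
  have hmem : η ∈ FivePoint.loopSpace D₅ r := by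
    unfold FivePoint.loopSpace
    rw [Finset.mem_filter, Finset.mem_powerset, fivePoint_hBonds_eq, hBonds_eq_of_verts_eq' D hV, hV]
    refine ⟨hη, fun F hF => ?_⟩
    rw [hpar F hF]
    constructor
    · rintro (h | h | h | h)
      · exact ⟨r + 1, n1, by rw [fivePoint_isCornerFace_iff, isCornerFace_iff_eq_yc, hyc, h]⟩
      · exact ⟨r + 2, n2, by rw [fivePoint_isCornerFace_iff, isCornerFace_iff_eq_yc, hyc, h]⟩
      · exact ⟨r + 3, n3, by rw [fivePoint_isCornerFace_iff, isCornerFace_iff_eq_yc, hyc, h]⟩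
      · exact ⟨r + 4, n4, by rw [fivePoint_isCornerFace_iff, isCornerFace_iff_eq_yc, hyc, h]⟩
    · rintro ⟨t, ht, hF'⟩
      rw [fivePoint_isCornerFace_iff, isCornerFace_iff_eq_yc, hyc] at hF'
      rcases (fin5_ne_iff r t).1 ht with rfl | rfl | rfl | rfl
      · exact Or.inl hF'
      · exact Or.inr (Or.inl hF')
      · exact Or.inr (Or.inr (Or.inl hF'))
      · exact Or.inr (Or.inr (Or.inr hF'))
  obtain ⟨σ, hσ⟩ := FivePoint.loopSurj_holds D₅ r false η hmem
  have hL := (FivePoint.fiveMarkedLoopLemma_holds D₅ σ r).1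
  -- odd corners, touching, distinct
  have hodd : ∀ t : Fin 5, t ≠ r → Odd (xiDeg η (yc D (c t))) := by
    intro t ht
    rw [hpar _ (yc_mem_touching D _)]
    rcases (fin5_ne_iff r t).1 ht with rfl | rfl | rfl | rfl
    · exact Or.inl rfl
    · exact Or.inr (Or.inl rfl)
    · exact Or.inr (Or.inr (Or.inl rfl))
    · exact Or.inr (Or.inr (Or.inr rfl))
  have hinj : ∀ t t' : Fin 5, yc D (c t) = yc D (c t') → t = t' := fun t t' h => hc.injective (yc_injective D h)
  have huniq := (odd_component D hη hdeg (yc_mem_touching D (c (r + 1))) (hodd _ n1)).2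
  have hR13 : (sideGraph η).Reachable (yc D (c (r + 1))) (yc D (c (r + 3))) := (xiLinked_iff_reachable _ _ _).1 h13
  -- the link pattern of the colouring is A or B: `y'_{r+1}` is matched to an ADJACENT corner
  have key : ∀ t : Fin 5, t ≠ r → t ≠ r + 1 → t ≠ r + 3 →
      Relation.ReflTransGen (FivePoint.IStep D₅ σ r false) (yc D₅ (r + 1)) (yc D₅ t) → False := by
    intro t ht ht1 ht3 hreach
    have hl : XiLinked η (yc D (c (r + 1))) (yc D (c t)) := by
      rw [← hyc, ← hyc, ← hσ]; exact (FivePoint.xiLinked_xiOf_iff D₅ σ r false _ _).2 hreach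
    have hRt := (xiLinked_iff_reachable _ _ _).1 hl
    have := huniq _ _ hRt hR13 (hodd t ht) (hodd _ n3) (fun h => ht1 (hinj _ _ h)) (fun h => n13.symm (hinj _ _ h))
    exact ht3 (hinj _ _ this)
  have cornerA : ∀ {j : Fin 5} {Y : HexVertex}, FivePoint.IsCornerFace D₅ j Y → Y = yc D₅ j := fun h =>
    eq_yc D₅ ((fivePoint_isCornerFace_iff D₅ _ _).1 h)
  rcases hL.or with ⟨Y₁, Y₂, h1, h2, hreach⟩ | ⟨Y₁, Y₂, h1, h2, hreach⟩
  · rw [cornerA h1, cornerA h2] at hreach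
    exact key (r + 2) n2 n12.symm n23 hreach
  · rw [cornerA h1, cornerA h2] at hreach
    exact key (r + 4) n4 n14.symm n34.symm hreach

/-- ★ **NO TWO STRANDS WITH INTERLEAVED ODD CORNER ENDPOINTS (linear form)**: for corners `a < b < c < d` of a `k`-marked domain with a
fifth mark `e`, a configuration of `H_G` with all side counts `≤ 2` in which `y_a, y_b, y_c, y_d` are odd cannot link `a ~ c` and
`b ~ d`. [cite: KhristoforovSmirnov2021, §1.2 (arXiv v1 p. 2: «IP(ξ) is a union of disjoint paths, matching marked points»)] -/
theorem false_of_interleaved_links_lt {η : Finset (Sym2 (Site 2))} (hη : η ⊆ hBonds D) (hdeg : ∀ F, xiDeg η F ≤ 2)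
    {a b c d e : Fin nm} (hab : a < b) (hbc : b < c) (hcd : c < d) (hea : e ≠ a) (heb : e ≠ b) (hec : e ≠ c) (hed : e ≠ d)
    (hoa : Odd (xiDeg η (yc D a))) (hob : Odd (xiDeg η (yc D b))) (hoc : Odd (xiDeg η (yc D c))) (hod : Odd (xiDeg η (yc D d)))
    (hac : XiLinked η (yc D a) (yc D c)) (hbd : XiLinked η (yc D b) (yc D d)) : False := by
  classical
  -- cut the two strands out
  set S : Finset HexVertex := {yc D a, yc D b} with hS_def
  set η' := keepOn η S with hη'_def
  have hη' : η' ⊆ hBonds D := fun x hx => hη (keepOn_subset η S hx)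
  have hdeg' : ∀ F, xiDeg η' F ≤ 2 := fun F => (xiDeg_mono (keepOn_subset η S) F).trans (hdeg F)
  have hinj := yc_injective D
  have hRa := (odd_component D hη hdeg (yc_mem_touching D a) hoa).2
  have hRb := (odd_component D hη hdeg (yc_mem_touching D b) hob).2
  have rac : (sideGraph η).Reachable (yc D a) (yc D c) := (xiLinked_iff_reachable _ _ _).1 hac
  have rbd : (sideGraph η).Reachable (yc D b) (yc D d) := (xiLinked_iff_reachable _ _ _).1 hbd
  have nab : a ≠ b := hab.ne
  have nac : a ≠ c := (hab.trans hbc).ne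
  have nad : a ≠ d := ((hab.trans hbc).trans hcd).ne
  have nbc : b ≠ c := hbc.ne
  have nbd : b ≠ d := (hbc.trans hcd).ne
  have ncd : c ≠ d := hcd.ne
  -- the odd faces reachable from `y_a` are `y_a`, `y_c`; from `y_b`: `y_b`, `y_d`
  have oddA : ∀ F, (sideGraph η).Reachable (yc D a) F → Odd (xiDeg η F) → F = yc D a ∨ F = yc D c := by
    intro F hF hoF
    by_cases h : F = yc D a
    · exact Or.inl h
    · exact Or.inr ((hRa _ _ hF rac hoF hoc h (fun e => nac (hinj e).symm)).symm ▸ rfl)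
  have oddB : ∀ F, (sideGraph η).Reachable (yc D b) F → Odd (xiDeg η F) → F = yc D b ∨ F = yc D d := by
    intro F hF hoF
    by_cases h : F = yc D b
    · exact Or.inl h
    · exact Or.inr ((hRb _ _ hF rbd hoF hod h (fun e => nbd (hinj e).symm)).symm ▸ rfl)
  have hparity : ∀ F ∈ triFacesTouching D.verts, Odd (xiDeg η' F) ↔
      (F = yc D a ∨ F = yc D b ∨ F = yc D c ∨ F = yc D d) := by
    intro F hF
    by_cases hP : ∃ s ∈ S, (sideGraph η).Reachable s F
    · rw [hη'_def, xiDeg_keepOn_of_mem hP]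
      obtain ⟨s, hs, hsF⟩ := hP
      rw [hS_def, Finset.mem_insert, Finset.mem_singleton] at hs
      constructor
      · intro hoF
        rcases hs with rfl | rfl
        · rcases oddA F hsF hoF with h | h
          · exact Or.inl h
          · exact Or.inr (Or.inr (Or.inl h))
        · rcases oddB F hsF hoF with h | h
          · exact Or.inr (Or.inl h)
          · exact Or.inr (Or.inr (Or.inr h))
      · rintro (rfl | rfl | rfl | rfl)
        · exact hoa
        · exact hob
        · exact hoc
        · exact hod
    · rw [hη'_def, xiDeg_keepOn_of_not_mem (D := D) hη hP]
      constructor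
      · intro h; exact absurd h (by decide)
      · have hSa : yc D a ∈ S := by rw [hS_def]; exact Finset.mem_insert_self _ _
        have hSb : yc D b ∈ S := by rw [hS_def]; exact Finset.mem_insert_of_mem (Finset.mem_singleton_self _)
        rintro (rfl | rfl | rfl | rfl)
        · exact absurd ⟨_, hSa, SimpleGraph.Reachable.refl _⟩ hP
        · exact absurd ⟨_, hSb, SimpleGraph.Reachable.refl _⟩ hP
        · exact absurd ⟨_, hSa, rac⟩ hP
        · exact absurd ⟨_, hSb, rbd⟩ hP
  have hSa : ∃ s ∈ S, (sideGraph η).Reachable s (yc D a) := ⟨_, by rw [hS_def]; exact Finset.mem_insert_self _ _, SimpleGraph.Reachable.refl _⟩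
  have hSb : ∃ s ∈ S, (sideGraph η).Reachable s (yc D b) :=
    ⟨_, by rw [hS_def]; exact Finset.mem_insert_of_mem (Finset.mem_singleton_self _), SimpleGraph.Reachable.refl _⟩
  have hac' : XiLinked η' (yc D a) (yc D c) := xiLinked_keepOn hSa hac
  have hbd' : XiLinked η' (yc D b) (yc D d) := xiLinked_keepOn hSb hbd
  -- five increasing marks: the position of `e`
  have hea' := lt_or_gt_of_ne hea
  have heb' := lt_or_gt_of_ne heb
  have hec' := lt_or_gt_of_ne hec
  have hed' := lt_or_gt_of_ne hed
  rcases hea' with hea | hea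
  · -- e < a : marks (e, a, b, c, d), r = 0
    exact false_of_crossed_links₅ (D := D) hη' hdeg' ![e, a, b, c, d]
      (Fin.strictMono_iff_lt_succ.2 fun i => by fin_cases i <;> assumption) 0
      (x₁ := a) (x₂ := b) (x₃ := c) (x₄ := d) rfl rfl rfl rfl hparity hac'
  rcases heb' with heb | heb
  · -- a < e < b : marks (a, e, b, c, d), r = 1
    exact false_of_crossed_links₅ (D := D) hη' hdeg' ![a, e, b, c, d]
      (Fin.strictMono_iff_lt_succ.2 fun i => by fin_cases i <;> assumption) 1
      (x₁ := b) (x₂ := c) (x₃ := d) (x₄ := a) rfl rfl rfl rfl (fun F hF => (hparity F hF).trans or4_rot) hbd'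
  rcases hec' with hec | hec
  · -- b < e < c : marks (a, b, e, c, d), r = 2
    exact false_of_crossed_links₅ (D := D) hη' hdeg' ![a, b, e, c, d]
      (Fin.strictMono_iff_lt_succ.2 fun i => by fin_cases i <;> assumption) 2
      (x₁ := c) (x₂ := d) (x₃ := a) (x₄ := b) rfl rfl rfl rfl (fun F hF => (hparity F hF).trans (or4_rot.trans or4_rot))
      (xiLinked_symm' hac')
  rcases hed' with hed | hed
  · -- c < e < d : marks (a, b, c, e, d), r = 3
    exact false_of_crossed_links₅ (D := D) hη' hdeg' ![a, b, c, e, d]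
      (Fin.strictMono_iff_lt_succ.2 fun i => by fin_cases i <;> assumption) 3
      (x₁ := d) (x₂ := a) (x₃ := b) (x₄ := c) rfl rfl rfl rfl
      (fun F hF => (hparity F hF).trans (or4_rot.trans (or4_rot.trans or4_rot))) (xiLinked_symm' hbd')
  · -- d < e : marks (a, b, c, d, e), r = 4
    exact false_of_crossed_links₅ (D := D) hη' hdeg' ![a, b, c, d, e]
      (Fin.strictMono_iff_lt_succ.2 fun i => by fin_cases i <;> assumption) 4
      (x₁ := a) (x₂ := b) (x₃ := c) (x₄ := d) rfl rfl rfl rfl hparity hac'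

/-- **an anticlockwise quadruple of marks**: `(a, b, c, d)` cyclically increasing.
[cite: KhristoforovSmirnov2021, §1.2 (arXiv v1 p. 2: counterclockwise cyclic indexing)] -/
def CcwQuad (a b c d : Fin nm) : Prop :=
  (a < b ∧ b < c ∧ c < d) ∨ (b < c ∧ c < d ∧ d < a) ∨ (c < d ∧ d < a ∧ a < b) ∨ (d < a ∧ a < b ∧ b < c)

/-- ★★ **LINK PATTERNS ARE NON-CROSSING**: in a `k`-marked domain with a fifth mark `e ∉ {a, b, c, d}`, a configuration of `H_G` with
all side counts `≤ 2` in which the corners `y_a, y_b, y_c, y_d` (anticlockwise) are odd never links `a ~ c` and `b ~ d`.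
[cite: KhristoforovSmirnov2021, §1.2 (arXiv v1 p. 2: «IP(ξ) is a union of disjoint paths, matching marked points»)] -/
theorem false_of_interleaved_links {η : Finset (Sym2 (Site 2))} (hη : η ⊆ hBonds D) (hdeg : ∀ F, xiDeg η F ≤ 2)
    {a b c d e : Fin nm} (hq : CcwQuad a b c d) (hea : e ≠ a) (heb : e ≠ b) (hec : e ≠ c) (hed : e ≠ d)
    (hoa : Odd (xiDeg η (yc D a))) (hob : Odd (xiDeg η (yc D b))) (hoc : Odd (xiDeg η (yc D c))) (hod : Odd (xiDeg η (yc D d)))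
    (hac : XiLinked η (yc D a) (yc D c)) (hbd : XiLinked η (yc D b) (yc D d)) : False := by
  rcases hq with ⟨h1, h2, h3⟩ | ⟨h1, h2, h3⟩ | ⟨h1, h2, h3⟩ | ⟨h1, h2, h3⟩
  · exact false_of_interleaved_links_lt hη hdeg h1 h2 h3 hea heb hec hed hoa hob hoc hod hac hbd
  · exact false_of_interleaved_links_lt hη hdeg h1 h2 h3 heb hec hed hea hob hoc hod hoa hbd (xiLinked_symm' hac)
  · exact false_of_interleaved_links_lt hη hdeg h1 h2 h3 hec hed hea heb hoc hod hoa hob (xiLinked_symm' hac) (xiLinked_symm' hbd)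
  · exact false_of_interleaved_links_lt hη hdeg h1 h2 h3 hed hea heb hec hod hoa hob hoc (xiLinked_symm' hbd) hac

end NonCrossing

/-! # Part III — DISCRETE HOLOMORPHICITY OF CLASS-WEIGHTED `k`-DISORDER OBSERVABLES UNDER THE NON-CROSSING TRIPOD LAW

The generic Lemma 4. A CLASS WEIGHT is a function `wt j L` of the partner `j : Fin k` of the mid-edge `z` and of the LINK RELATION
`L ⊆ Fin k × Fin k` of the configuration among the corners (`linkRel`: ordered pairs `(a, b)`, `a ≠ b`, with `y_a ~ y_b`); the
class-weighted observable at the mid-edge of the `i`-th side of `v` is `ObsW wt v i = Σ_ξ wt (partner ξ) (linkRel ξ)` over both halves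
of the XOR space. A TRIPOD PICTURE `(α, β, γ; L₀)` is an anticlockwise triple with a symmetric irreflexive relation `L₀` on the other
corners, perfect on them, and PLANAR (no pair of `L₀` interleaves another pair of `L₀` or a pair of the triple). The TRIPOD LAW for
`wt`: `wt α (L₀ + βγ) + τ·wt β (L₀ + γα) + τ²·wt γ (L₀ + αβ) = 0` for every tripod picture. THEOREM (`holomorphicW_of_tripodLaw`):
the tripod law implies `Σ_{i : Fin 3} τ^i ObsW wt v i = 0` at every face `v` with three `H_G`-sides of every `k`-marked domain.
At `k = 3` the pictures have `L₀ = ∅`, the law for `wt j _ = τ^j` is `τ^α + τ^{β+1} + τ^{γ+2} = 0` for rotations, and the theorem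
is Khristoforov–Smirnov's Lemma 4 (`khsLemma4_of_tripodLaw`). -/

open Literature.Probability.Percolation.FivePoint (tau)
open Literature.Probability.Percolation.FivePoint.N5 (coreCompl coreEnd)

section LinkRel

variable {nm : ℕ} (D : TriMarkedDomain nm)

open Classical in
/-- **the link relation of a configuration among the corners**: ordered pairs `(a, b)`, `a ≠ b`, with `y_a` linked to `y_b`.
[cite: KhristoforovSmirnov2021, §1.2 (arXiv v1 p. 2: the link pattern of `IP(ξ)`)] -/
noncomputable def linkRel (ξ : Finset (Sym2 (Site 2))) : Finset (Fin nm × Fin nm) :=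
  Finset.univ.filter fun ab : Fin nm × Fin nm => ab.1 ≠ ab.2 ∧ XiLinked ξ (yc D ab.1) (yc D ab.2)

/-- adding a symmetric pair to a relation. [folklore] -/
def withPair (L : Finset (Fin nm × Fin nm)) (a b : Fin nm) : Finset (Fin nm × Fin nm) := insert (a, b) (insert (b, a) L)

variable {D}

/-- membership in the link relation. [cite: KhristoforovSmirnov2021, §1.2 (arXiv v1 p. 2)] -/
theorem mem_linkRel {ξ : Finset (Sym2 (Site 2))} {a b : Fin nm} :
    (a, b) ∈ linkRel D ξ ↔ a ≠ b ∧ XiLinked ξ (yc D a) (yc D b) := by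
  classical
  unfold linkRel
  rw [Finset.mem_filter]
  exact ⟨fun h => h.2, fun h => ⟨Finset.mem_univ _, h⟩⟩

/-- membership in `withPair`. [cite: KhristoforovSmirnov2021, §1.2 (arXiv v1 p. 2: the link pattern as a matching of marked points)] -/
theorem mem_withPair {L : Finset (Fin nm × Fin nm)} {a b x y : Fin nm} :
    (x, y) ∈ withPair L a b ↔ (x = a ∧ y = b) ∨ (x = b ∧ y = a) ∨ (x, y) ∈ L := by
  unfold withPair
  rw [Finset.mem_insert, Finset.mem_insert, Prod.mk.injEq, Prod.mk.injEq]

open Classical in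
/-- **the weight of a configuration** at the mid-edge of the `i`-th side of `v` (odd endpoint `s`): `wt (partner) (link relation)`,
summed over the (unique) partner. [cite: KhristoforovSmirnov2021, §2 Definition 3 and Lemma 4 (p. 4: `H(ξ) = Σ_j τ^j 1_{z ↔ u_j}`)] -/
noncomputable def GkW (wt : Fin nm → Finset (Fin nm × Fin nm) → ℂ) (v : HexVertex) (i : Fin 3) (s : HexVertex)
    (ξ : Finset (Sym2 (Site 2))) : ℂ :=
  ∑ j : Fin nm, if InClassX D (faceVertex v (i + 1)) (faceVertex v (i + 2)) s j ξ then wt j (linkRel D ξ) else 0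

variable (D) in
/-- **the class-weighted `k`-disorder observable** (un-normalised) at the mid-edge of the `i`-th side of `v`: both halves of the
subdivided edge. [cite: KhristoforovSmirnov2021, §2 Definition 3 (p. 4: `F(z) = E[H(ξ)]`); §1.2 (p. 2: the law of the link pattern)] -/
noncomputable def ObsW (wt : Fin nm → Finset (Fin nm × Fin nm) → ℂ) (v : HexVertex) (i : Fin 3) : ℂ :=
  ∑ ξ ∈ TXb D v i v, GkW (D := D) wt v i v ξ + ∑ ξ ∈ TXb D v i (oppFace v i), GkW (D := D) wt v i (oppFace v i) ξ

/-- **a TRIPOD PICTURE**: an anticlockwise triple of corners `(α, β, γ)` and a relation `L₀` on the OTHER corners which is symmetric,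
irreflexive, perfect (every other corner has exactly one partner) and PLANAR together with the three chords of the triple (no pair of
`L₀` interleaves a pair of `L₀ ∪ {αβ, βγ, γα}`) — the combinatorial shape of the link pattern of a re-linking core.
[cite: KhristoforovSmirnov2021, §2 Lemma 4, proof and Fig. 3 (p. 4); §1.2 (p. 2: «IP(ξ) is a union of disjoint paths, matching marked points»)] -/
structure TripodPicture (α β γ : Fin nm) (L₀ : Finset (Fin nm × Fin nm)) : Prop where
  ccw : CcwTriple α β γ
  symm : ∀ a b, (a, b) ∈ L₀ → (b, a) ∈ L₀
  irrefl : ∀ a, (a, a) ∉ L₀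
  off : ∀ a b, (a, b) ∈ L₀ → a ≠ α ∧ a ≠ β ∧ a ≠ γ
  perfect : ∀ a, a ≠ α → a ≠ β → a ≠ γ → ∃! b, (a, b) ∈ L₀
  planar : ∀ x y z w, (x, z) ∈ withPair (withPair (withPair L₀ α β) β γ) γ α → (y, w) ∈ L₀ → ¬ CcwQuad x y z w

/-- **the TRIPOD LAW for a class weight** `wt`: on every tripod picture, `wt α (L₀+βγ) + τ·wt β (L₀+γα) + τ²·wt γ (L₀+αβ) = 0`.
[cite: KhristoforovSmirnov2021, §2 Lemma 4, proof and Fig. 3 (p. 4: «each triple contributes zero»)] -/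
def TripodLaw (wt : Fin nm → Finset (Fin nm × Fin nm) → ℂ) : Prop :=
  ∀ (α β γ : Fin nm) (L₀ : Finset (Fin nm × Fin nm)), TripodPicture α β γ L₀ →
    wt α (withPair L₀ β γ) + tau * wt β (withPair L₀ γ α) + tau ^ 2 * wt γ (withPair L₀ α β) = 0

variable (D) in
/-- **discrete holomorphicity of the class-weighted observable**: `Σ_{i : Fin 3} τ^i ObsW wt v i = 0` at every face `v` with three
`H_G`-sides (sides indexed by `oppFace`, anticlockwise up to rotation). [cite: KhristoforovSmirnov2021, §2 Lemma 4 eq. (3) (p. 4)] -/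
def HolomorphicW (wt : Fin nm → Finset (Fin nm × Fin nm) → ℂ) : Prop :=
  ∀ v : HexVertex, AllSides D v → ∑ i : Fin 3, tau ^ (i : ℕ) * ObsW D wt v i = 0

end LinkRel

/-! ### The link relation of a completion -/

section ComplLink

variable {nm : ℕ} {D : TriMarkedDomain nm} {v : HexVertex} (hv : AllSides D v)

/-- the two touching faces of an `H_G`-side of `W` are `W` and the face across. [cite: BollobasRiordan2006, Ch. 7 §7.2.2 pp. 191–193] -/
private theorem exists_side_eq_iff' {W F : HexVertex} {j : Fin 3} (hb : side W j ∈ hBonds D) (hF : F ∈ triFacesTouching D.verts) :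
    (∃ i : Fin 3, side F i = side W j) ↔ (F = W ∨ F = oppFace W j) := by
  have hWt : W ∈ triFacesTouching D.verts := mem_touching_of_side_mem D hb
  have hOt : oppFace W j ∈ triFacesTouching D.verts :=
    mem_touching_of_side_mem D (j := oppIdx W j) (by rw [side_oppFace_oppIdx]; exact hb)
  have hne : W ≠ oppFace W j := (hexGraph_adj_oppFace W j).ne
  constructor
  · rintro ⟨i, hi⟩
    exact eq_or_eq_of_inc_three D hb hWt hOt hF (inc_side W j) (by rw [← side_oppFace_oppIdx]; exact inc_side _ _)
      (by rw [← hi]; exact inc_side F i) hne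
  · rintro (rfl | rfl)
    · exact ⟨j, rfl⟩
    · exact ⟨oppIdx W j, side_oppFace_oppIdx W j⟩

include hv in
/-- **attachment** (the tree's private `hbK_reach_attach`, restated): reachability in `A ∪ {sides of v indexed by T}` from a face
`Y ≠ v`. [cite: KhristoforovSmirnov2021, §2 Lemma 4 (p. 4), proof and Fig. 3] -/
theorem reach_attach {A : Finset (Sym2 (Site 2))} (hAv : ∀ j : Fin 3, side v j ∉ A) (T : Finset (Fin 3)) {Y : HexVertex}
    (hY : Y ≠ v) (F : HexVertex) :
    (sideGraph (A ∪ T.image (side v))).Reachable Y F ↔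
      (F ≠ v ∧ ((sideGraph A).Reachable Y F ∨
        ∃ i ∈ T, ∃ i' ∈ T, (sideGraph A).Reachable Y (oppFace v i) ∧ (sideGraph A).Reachable (oppFace v i') F)) ∨
      (F = v ∧ ∃ i ∈ T, (sideGraph A).Reachable Y (oppFace v i)) := by
  classical
  have hvi : ∀ i ∈ T, (sideGraph (A ∪ T.image (side v))).Adj v (oppFace v i) := fun i hi =>
    ⟨i, rfl, Finset.mem_union_right _ (Finset.mem_image.2 ⟨i, hi, rfl⟩)⟩
  have hle : sideGraph A ≤ sideGraph (A ∪ T.image (side v)) := fun a b ⟨j, hb, hj⟩ => ⟨j, hb, Finset.mem_union_left _ hj⟩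
  constructor
  · intro h
    rw [SimpleGraph.reachable_iff_reflTransGen] at h
    induction h with
    | refl => exact Or.inl ⟨hY, Or.inl SimpleGraph.Reachable.rfl⟩
    | @tail b c _ hbc ih =>
      obtain ⟨j, hc, hj⟩ := hbc
      rcases ih with ⟨hbv, hb⟩ | ⟨hbv, i, hi, hri⟩
      · rcases Finset.mem_union.1 hj with hjA | hjX
        · have hcv : c ≠ v := by
            intro hcv
            rw [hcv] at hc
            have hs : side v (oppIdx b j) = side b j := by rw [hc, side_oppFace_oppIdx]
            exact hAv (oppIdx b j) (hs ▸ hjA)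
          have hstep : (sideGraph A).Adj b c := ⟨j, hc, hjA⟩
          refine Or.inl ⟨hcv, ?_⟩
          rcases hb with hb | ⟨i, hi, i', hi', h1, h2⟩
          · exact Or.inl (hb.trans hstep.reachable)
          · exact Or.inr ⟨i, hi, i', hi', h1, h2.trans hstep.reachable⟩
        · obtain ⟨i, hiT, hside⟩ := Finset.mem_image.1 hjX
          have hbt : b ∈ triFacesTouching D.verts := mem_touching_of_side_mem D (hside ▸ hv i)
          rcases (exists_side_eq_iff' (hv i) hbt).1 ⟨j, hside.symm⟩ with hb1 | hb1
          · exact absurd hb1 hbv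
          · have hjidx : j = oppIdx v i := by
              rw [hb1, ← side_oppFace_oppIdx v i] at hside
              exact (FivePoint.side_injective _ hside).symm
            have hcv : c = v := by rw [hc, hb1, hjidx, oppFace_oppFace]
            refine Or.inr ⟨hcv, ?_⟩
            rcases hb with hb | ⟨i₁, hi₁, i', -, h1, -⟩
            · exact ⟨i, hiT, hb1 ▸ hb⟩
            · exact ⟨i₁, hi₁, h1⟩
      · rw [hbv] at hc hj
        have hjT : j ∈ T := by
          rcases Finset.mem_union.1 hj with hjA | hjX
          · exact absurd hjA (hAv j)
          · obtain ⟨i', hi', he⟩ := Finset.mem_image.1 hjX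
            rw [← FivePoint.side_injective _ he]; exact hi'
        have hcv : c ≠ v := by rw [hc]; exact (hexGraph_adj_oppFace _ j).ne.symm
        exact Or.inl ⟨hcv, Or.inr ⟨i, hi, j, hjT, hri, by rw [hc]⟩⟩
  · rintro (⟨-, h | ⟨i, hi, i', hi', h1, h2⟩⟩ | ⟨hFv, i, hi, h⟩)
    · exact h.mono hle
    · have s1 : (sideGraph (A ∪ T.image (side v))).Adj (oppFace v i) v := (hvi i hi).symm
      have s2 : (sideGraph (A ∪ T.image (side v))).Adj v (oppFace v i') := hvi i' hi'
      exact (((h1.mono hle).trans s1.reachable).trans s2.reachable).trans (h2.mono hle)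
    · subst hFv
      exact (h.mono hle).trans (hvi i hi).symm.reachable

/-- a core avoids the sides of `v` (any odd-neighbour set). [cite: KhristoforovSmirnov2021, §2 Lemma 4 (p. 4), proof and Fig. 3] -/
private theorem sides_not_mem_core {S : Finset (Fin 3)} {ζ : Finset (Sym2 (Site 2))} (hq : IsCoreb D v S ζ) (j : Fin 3) :
    side v j ∉ ζ := fun hb => by
  have h := hq.1 hb
  unfold Eminus at h
  exact (Finset.mem_filter.1 h).2 j rfl

/-- Auxiliary. [folklore] -/
private theorem fin3_two_pairs {i₀ i₁ i i' : Fin 3} (h : i₀ ≠ i₁) (hi : i ≠ i') : i = i₀ ∨ i = i₁ ∨ i' = i₀ ∨ i' = i₁ := by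
  revert i₀ i₁ i i'; decide

include hv in
/-- **links of corners in the completion of an INVARIANT core are the links of the core**: the attached sides of `v` join corners only
through two `S`-neighbours, which are then either the same neighbour, or blind. [cite: KhristoforovSmirnov2021, §2 Lemma 4 (p. 4), proof and Fig. 3] -/
theorem xiLinked_coreCompl_iff_of_inv {S : Finset (Fin 3)} {ζ : Finset (Sym2 (Site 2))} (hq : IsCoreb D v S ζ)
    (hinv : S.card = 1 ∨ ∃ i ∈ S, ∃ i' ∈ S, i ≠ i' ∧ XiLinked ζ (oppFace v i) (oppFace v i'))
    (k : Fin 3) (a b : Fin nm) :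
    XiLinked (coreCompl v S k ζ) (yc D a) (yc D b) ↔ XiLinked ζ (yc D a) (yc D b) := by
  classical
  constructor
  · intro h
    rw [xiLinked_iff_reachable] at h ⊢
    unfold coreCompl at h
    rcases (reach_attach hv (sides_not_mem_core hq) (S.erase k) (hbK_yc_ne_v hv a) (yc D b)).1 h with
      ⟨-, h1 | ⟨i, hi, i', hi', h1, h2⟩⟩ | ⟨hbv, -⟩
    · exact h1
    · have hiS := Finset.mem_of_mem_erase hi
      have hi'S := Finset.mem_of_mem_erase hi'
      by_cases hii' : i = i'
      · subst hii'; exact h1.trans h2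
      · -- two distinct `S`-neighbours: the core is not of cardinality one, so two neighbours are linked and blind
        rcases hinv with hc1 | ⟨i₀, h0, i₁, h10, hne, hl⟩
        · exact absurd (Finset.card_le_one.1 hc1.le i hiS i' hi'S) hii'
        · rw [xiLinked_iff_reachable] at hl
          have hbl := fun j => hbK_blind hv hq h0 h10 hne hl j
          rcases fin3_two_pairs hne hii' with rfl | rfl | rfl | rfl
          · exact absurd h1.symm (hbl a).1
          · exact absurd h1.symm (hbl a).2
          · exact absurd h2 (hbl b).1
          · exact absurd h2 (hbl b).2
    · exact absurd hbv (hbK_yc_ne_v hv b)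
  · intro h
    exact xiLinked_mono (by unfold coreCompl; exact Finset.subset_union_left) h

include hv in
/-- hence the link relation of every completion of an invariant core is that of the core. [cite: KhristoforovSmirnov2021, §2 Lemma 4 (p. 4), proof and Fig. 3] -/
theorem linkRel_coreCompl_of_inv {S : Finset (Fin 3)} {ζ : Finset (Sym2 (Site 2))} (hq : IsCoreb D v S ζ)
    (hinv : S.card = 1 ∨ ∃ i ∈ S, ∃ i' ∈ S, i ≠ i' ∧ XiLinked ζ (oppFace v i) (oppFace v i'))
    (k : Fin 3) : linkRel D (coreCompl v S k ζ) = linkRel D ζ := by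
  ext ⟨a, b⟩
  rw [mem_linkRel, mem_linkRel, xiLinked_coreCompl_iff_of_inv hv hq hinv]

end ComplLink

section ReLinkCompl

variable {nm : ℕ} {D : TriMarkedDomain nm} {v : HexVertex} (hv : AllSides D v) {ζ : Finset (Sym2 (Site 2))}
  (hq : IsCoreb D v Finset.univ ζ) (hnl : ∀ i i' : Fin 3, i ≠ i' → ¬ XiLinked ζ (oppFace v i) (oppFace v i'))
  {p : Fin 3 → Fin nm} (hp : ∀ i : Fin 3, XiLinked ζ (oppFace v i) (yc D (p i)))
include hv hq hnl hp

omit hv hq hnl in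
/-- reachability form of the partner hypothesis. [cite: KhristoforovSmirnov2021, §2 Lemma 4 (p. 4), proof and Fig. 3] -/
private theorem hpR (i : Fin 3) : (sideGraph ζ).Reachable (oppFace v i) (yc D (p i)) := (xiLinked_iff_reachable _ _ _).1 (hp i)

omit hnl in
/-- a corner linked to a neighbour is its partner. [cite: KhristoforovSmirnov2021, §2 Lemma 4 (p. 4), proof and Fig. 3] -/
theorem eq_partner_of_linked {i : Fin 3} {a : Fin nm} (h : XiLinked ζ (oppFace v i) (yc D a)) : a = p i :=
  partner_unique hv hq ((xiLinked_iff_reachable _ _ _).1 h) (hpR hp i)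

omit hv hq hnl hp in
/-- Auxiliary. [folklore] -/
private theorem fin3_erase (k i : Fin 3) : i ≠ k ↔ (i = k + 1 ∨ i = k + 2) := by
  revert k i; decide

/-- ★ **the link relation of the completion at `k` of a RE-LINKING core**: the links of the core plus the new pair
`{p(k+1), p(k+2)}` (the two attached neighbours are joined through `v`). [cite: KhristoforovSmirnov2021, §2 Lemma 4 (p. 4), proof and Fig. 3 (the re-linking row)] -/
theorem linkRel_coreCompl_relink (k : Fin 3) :
    linkRel D (coreCompl v Finset.univ k ζ) = withPair (linkRel D ζ) (p (k + 1)) (p (k + 2)) := by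
  classical
  have hk1 : k + 1 ≠ k := by revert k; decide
  have hk2 : k + 2 ≠ k := by revert k; decide
  have hk12 : k + 1 ≠ k + 2 := by revert k; decide
  have hinj : Function.Injective p := partners_injective hnl hp
  ext ⟨a, b⟩
  rw [mem_linkRel, mem_withPair, mem_linkRel, xiLinked_iff_reachable, xiLinked_iff_reachable]
  unfold coreCompl
  rw [reach_attach hv (sides_not_mem_core hq) (Finset.univ.erase k) (hbK_yc_ne_v hv a) (yc D b)]
  have hbv := hbK_yc_ne_v hv b
  constructor
  · rintro ⟨hab, ⟨-, h1 | ⟨i, hi, i', hi', h1, h2⟩⟩ | ⟨hbv', -⟩⟩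
    · exact Or.inr (Or.inr ⟨hab, h1⟩)
    · have ha : a = p i := eq_partner_of_linked hv hq hp ((xiLinked_iff_reachable _ _ _).2 h1.symm)
      have hb : b = p i' := eq_partner_of_linked hv hq hp ((xiLinked_iff_reachable _ _ _).2 h2)
      have hii' : i ≠ i' := fun e => hab (by rw [ha, hb, e])
      rw [Finset.mem_erase] at hi hi'
      rcases (fin3_erase k i).1 hi.1 with rfl | rfl
      · rcases (fin3_erase k i').1 hi'.1 with rfl | rfl
        · exact absurd rfl hii'
        · exact Or.inl ⟨ha, hb⟩
      · rcases (fin3_erase k i').1 hi'.1 with rfl | rfl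
        · exact Or.inr (Or.inl ⟨ha, hb⟩)
        · exact absurd rfl hii'
    · exact absurd hbv' hbv
  · rintro (⟨rfl, rfl⟩ | ⟨rfl, rfl⟩ | ⟨hab, h⟩)
    · exact ⟨fun e => hk12 (hinj e), Or.inl ⟨hbv, Or.inr ⟨k + 1, Finset.mem_erase.2 ⟨hk1, Finset.mem_univ _⟩, k + 2,
        Finset.mem_erase.2 ⟨hk2, Finset.mem_univ _⟩, (hpR hp _).symm, hpR hp _⟩⟩⟩
    · exact ⟨fun e => hk12 (hinj e).symm, Or.inl ⟨hbv, Or.inr ⟨k + 2, Finset.mem_erase.2 ⟨hk2, Finset.mem_univ _⟩, k + 1,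
        Finset.mem_erase.2 ⟨hk1, Finset.mem_univ _⟩, (hpR hp _).symm, hpR hp _⟩⟩⟩
    · exact ⟨hab, Or.inl ⟨hbv, Or.inl h⟩⟩

omit hnl in
/-- a non-partner corner is no neighbour of `v` (a corner neighbour is its own partner). [cite: KhristoforovSmirnov2021, §2 Lemma 4 (p. 4), proof and Fig. 3] -/
theorem oppFace_ne_yc_of_not_partner {a : Fin nm} (ha : ∀ i, a ≠ p i) (i : Fin 3) : oppFace v i ≠ yc D a := by
  intro e
  have hc : oppFace v i ∈ corners D := by rw [e]; exact yc_mem_corners D a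
  have h0 := xiDeg_eq_zero_of_corner_nbr hv hq hc
  have := eq_of_reachable_of_xiDeg_eq_zero h0 (hpR hp i)
  rw [e] at this
  exact ha i (yc_injective D this.symm)

omit hnl in
/-- a non-partner corner is odd in the core. [cite: KhristoforovSmirnov2021, §2 Lemma 4 (p. 4), proof and Fig. 3] -/
theorem odd_yc_of_not_partner {a : Fin nm} (ha : ∀ i, a ≠ p i) : Odd (xiDeg ζ (yc D a)) :=
  hbK_odd_yc hq a (fun i _ => oppFace_ne_yc_of_not_partner hv hq hp ha i)

omit hnl in
/-- a member of a link pair of the core is a non-partner (partners are blind towards the other corners). [cite: KhristoforovSmirnov2021, §2 Lemma 4 (p. 4), proof and Fig. 3] -/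
theorem not_partner_of_mem_linkRel {a b : Fin nm} (h : (a, b) ∈ linkRel D ζ) (i : Fin 3) : a ≠ p i := by
  intro e
  rw [mem_linkRel] at h
  subst e
  exact hcK_partner_blind hv hq (hpR hp) i (Ne.symm h.1) ((xiLinked_iff_reachable _ _ _).1 h.2)

/-- ★ **the link relation of a re-linking core, with its partner triple, is a TRIPOD PICTURE** (anticlockwise by the re-linking law;
perfect by the path structure of the core; planar by the non-crossing lemma applied to the core and to its completions).
[cite: KhristoforovSmirnov2021, §2 Lemma 4, proof and Fig. 3 (p. 4); §1.2 (p. 2)] -/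
theorem tripodPicture_of_core : TripodPicture (p 0) (p 1) (p 2) (linkRel D ζ) := by
  classical
  have hζh : ζ ⊆ hBonds D := core_subset_hBonds hq
  have hdeg := core_xiDeg_le_two hq
  have hinj : Function.Injective p := partners_injective hnl hp
  have hR := hpR hp
  -- non-partners
  have hnp : ∀ {a b : Fin nm}, (a, b) ∈ linkRel D ζ → ∀ i, a ≠ p i := fun h => not_partner_of_mem_linkRel hv hq hp h
  have hsymm : ∀ a b, (a, b) ∈ linkRel D ζ → (b, a) ∈ linkRel D ζ := fun a b h => by
    rw [mem_linkRel] at h ⊢; exact ⟨h.1.symm, xiLinked_symm' h.2⟩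
  refine ⟨reLinkingK_holds D v hv ζ hq hnl p hp, hsymm, fun a h => (mem_linkRel.1 h).1 rfl,
    fun a b h => ⟨hnp h 0, hnp h 1, hnp h 2⟩, fun a h0 h1 h2 => ?_, fun x y z w hxz hyw hq4 => ?_⟩
  · -- perfect: the strand from the odd corner `y_a` ends at another corner
    have h3 : ∀ i : Fin 3, i = 0 ∨ i = 1 ∨ i = 2 := by decide
    have ha : ∀ i, a ≠ p i := fun i => by rcases h3 i with rfl | rfl | rfl <;> assumption
    have hoa := odd_yc_of_not_partner hv hq hp ha
    obtain ⟨⟨Y, hYne, hYodd, hreach⟩, huniq⟩ := odd_component D hζh hdeg (yc_mem_touching D a) hoa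
    have hYt : Y ∈ triFacesTouching D.verts := touching_of_reachable D hζh (yc_mem_touching D a) hreach
    -- `Y` is odd, hence a corner or a neighbour; a neighbour would make `a` a partner
    have hYc : Y ∈ corners D := by
      rcases Finset.mem_symmDiff.1 ((hq.2.2 Y hYt).1 hYodd) with ⟨hc, -⟩ | ⟨hN, -⟩
      · exact hc
      · exfalso
        obtain ⟨i, -, rfl⟩ := Finset.mem_image.1 hN
        exact ha i (eq_partner_of_linked hv hq hp (xiLinked_symm' ((xiLinked_iff_reachable _ _ _).2 hreach)))
    obtain ⟨b, rfl⟩ := (mem_corners D).1 hYc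
    refine ⟨b, mem_linkRel.2 ⟨fun e => hYne (by rw [e]), (xiLinked_iff_reachable _ _ _).2 hreach⟩, fun b' hb'0 => ?_⟩
    have hb' : a ≠ b' ∧ XiLinked ζ (yc D a) (yc D b') := mem_linkRel.1 hb'0
    have hb'np : ∀ i, b' ≠ p i := fun i e => by
      subst e
      exact hcK_partner_blind hv hq hR i hb'.1 ((xiLinked_iff_reachable _ _ _).1 (xiLinked_symm' hb'.2))
    have hob' := odd_yc_of_not_partner hv hq hp hb'np
    exact yc_injective D (huniq _ _ ((xiLinked_iff_reachable _ _ _).1 hb'.2) hreach hob' hYodd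
      (fun e => hb'.1 (yc_injective D e).symm) hYne)
  · -- planar: no pair of the core's links interleaves another one, or a chord of the tripod
    have hy : ∀ i, y ≠ p i := hnp hyw
    have hw : ∀ i, w ≠ p i := hnp (hsymm _ _ hyw)
    have hoy := odd_yc_of_not_partner hv hq hp hy
    have how := odd_yc_of_not_partner hv hq hp hw
    have hlyw : XiLinked ζ (yc D y) (yc D w) := (mem_linkRel.1 hyw).2
    rw [mem_withPair, mem_withPair, mem_withPair] at hxz
    -- the tripod chords: completions of the core
    have chord : ∀ j j' j'' : Fin 3, j ≠ j' → j'' ≠ j → j'' ≠ j' → x = p j → z = p j' → False := by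
      intro j j' j'' hjj' hj''j hj''j' hx hz
      subst hx hz
      -- the completion at `j''` joins `p j` and `p j'` through `v`
      set η := coreCompl v Finset.univ j'' ζ with hη_def
      have hmem : η ∈ TXb D v j'' (oppFace v j'') := by
        have := hbK_compl_mem hv j'' Finset.univ ζ hq
        unfold coreEnd at this
        rw [if_pos (Finset.mem_univ _)] at this
        exact this
      have hηsub := ((mem_TXb_iff (D := D) v j'' (oppFace v j'') η).1 hmem).1
      have hηpar := ((mem_TXb_iff (D := D) v j'' (oppFace v j'') η).1 hmem).2
      have hηh : η ⊆ hBonds D := fun b hb => Finset.mem_of_mem_erase (hηsub hb)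
      have hηdeg : ∀ F, xiDeg η F ≤ 2 :=
        xiDeg_le_two_of_mem_TXb D j'' (s := oppFace v j'') (by simp) hmem
      -- odd corners of the completion: all corners other than the face `oppFace v j''`
      have hoddη : ∀ a : Fin nm, yc D a ≠ oppFace v j'' → Odd (xiDeg η (yc D a)) := by
        intro a hne
        rw [hηpar _ (yc_mem_touching D a), Finset.mem_symmDiff, Finset.mem_singleton]
        exact Or.inl ⟨yc_mem_corners D a, hne⟩
      have hne_p : ∀ i, i ≠ j'' → yc D (p i) ≠ oppFace v j'' := by
        intro i hi e
        have hc : oppFace v j'' ∈ corners D := by rw [← e]; exact yc_mem_corners D _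
        have h0 := xiDeg_eq_zero_of_corner_nbr hv hq hc
        have := eq_of_reachable_of_xiDeg_eq_zero h0 (hR j'')
        exact hi (hinj (yc_injective D (e.trans this.symm)))
      have hlink : XiLinked η (yc D (p j)) (yc D (p j')) := by
        have : (p j, p j') ∈ withPair (linkRel D ζ) (p (j'' + 1)) (p (j'' + 2)) := by
          rw [mem_withPair]
          rcases (fin3_erase j'' j).1 hj''j.symm with hj1 | hj2
          · rcases (fin3_erase j'' j').1 hj''j'.symm with hj'1 | hj'2
            · exact absurd (hj1.trans hj'1.symm) hjj'
            · exact Or.inl ⟨by rw [hj1], by rw [hj'2]⟩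
          · rcases (fin3_erase j'' j').1 hj''j'.symm with hj'1 | hj'2
            · exact Or.inr (Or.inl ⟨by rw [hj2], by rw [hj'1]⟩)
            · exact absurd (hj2.trans hj'2.symm) hjj'
        have h' : (p j, p j') ∈ linkRel D (coreCompl v Finset.univ j'' ζ) := by
          rw [linkRel_coreCompl_relink hv hq hnl hp j'']; exact this
        exact (mem_linkRel.1 h').2
      exact false_of_interleaved_links (D := D) hηh hηdeg hq4 (e := p j'')
        (fun e => hj''j (hinj e)) (fun e => hy j'' e.symm) (fun e => hj''j' (hinj e)) (fun e => hw j'' e.symm)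
        (hoddη _ (hne_p j hj''j.symm)) (hoddη _ (oppFace_ne_yc_of_not_partner hv hq hp hy j'').symm)
        (hoddη _ (hne_p j' hj''j'.symm)) (hoddη _ (oppFace_ne_yc_of_not_partner hv hq hp hw j'').symm)
        hlink (xiLinked_mono (by rw [hη_def]; unfold coreCompl; exact Finset.subset_union_left) hlyw)
    rcases hxz with ⟨hx, hz⟩ | ⟨hx, hz⟩ | ⟨hx, hz⟩ | ⟨hx, hz⟩ | ⟨hx, hz⟩ | ⟨hx, hz⟩ | hxz
    · exact chord 2 0 1 (by decide) (by decide) (by decide) hx hz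
    · exact chord 0 2 1 (by decide) (by decide) (by decide) hx hz
    · exact chord 1 2 0 (by decide) (by decide) (by decide) hx hz
    · exact chord 2 1 0 (by decide) (by decide) (by decide) hx hz
    · exact chord 0 1 2 (by decide) (by decide) (by decide) hx hz
    · exact chord 1 0 2 (by decide) (by decide) (by decide) hx hz
    · -- two pairs of the core
      have hx : ∀ i, x ≠ p i := hnp hxz
      have hz : ∀ i, z ≠ p i := hnp (hsymm _ _ hxz)
      exact false_of_interleaved_links (D := D) hζh hdeg hq4 (e := p 0) (hx 0).symm (hy 0).symm (hz 0).symm (hw 0).symm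
        (odd_yc_of_not_partner hv hq hp hx) hoy (odd_yc_of_not_partner hv hq hp hz) how
        (mem_linkRel.1 hxz).2 hlyw

end ReLinkCompl

/-! ### Assembly: the tripod law implies discrete holomorphicity -/

section Assembly

variable {nm : ℕ} {D : TriMarkedDomain nm}

/-- `τ² + τ + 1 = 0`. [folklore] -/
private theorem tau_sum' : 1 + tau + tau ^ 2 = 0 := by
  have hprim : IsPrimitiveRoot tau 3 := by
    have h := Complex.isPrimitiveRoot_exp 3 (by norm_num)
    unfold tau
    convert h using 2
    push_cast
    ring
  have h := hprim.geom_sum_eq_zero (by norm_num : 1 < 3)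
  simp only [Finset.sum_range_succ, Finset.sum_range_zero, pow_zero, pow_one, zero_add] at h
  linear_combination h

/-- the weight of a completion is `wt j₀ (linkRel)` for its unique class `j₀`. [cite: KhristoforovSmirnov2021, §2 Lemma 4 (p. 4), proof] -/
theorem gkW_compl_eq (wt : Fin nm → Finset (Fin nm × Fin nm) → ℂ) {v : HexVertex} (hv : AllSides D v) {S : Finset (Fin 3)}
    {ζ : Finset (Sym2 (Site 2))} (hq : IsCoreb D v S ζ) (i : Fin 3) {j₀ : Fin nm} (hj₀ : ComplClassX D v S i ζ j₀) :
    GkW (D := D) wt v i (coreEnd v S i) (coreCompl v S i ζ) = wt j₀ (linkRel D (coreCompl v S i ζ)) := by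
  classical
  obtain ⟨j₁, -, huniq⟩ := hbK_complClass_existsUnique hv hq i
  have hcls : ∀ j : Fin nm, ComplClassX D v S i ζ j ↔ j = j₀ := fun j =>
    ⟨fun h => (huniq j h).trans (huniq j₀ hj₀).symm, fun h => h ▸ hj₀⟩
  unfold GkW
  have : ∀ j : Fin nm, (if InClassX D (faceVertex v (i + 1)) (faceVertex v (i + 2)) (coreEnd v S i) j (coreCompl v S i ζ)
      then wt j (linkRel D (coreCompl v S i ζ)) else (0 : ℂ)) = if j = j₀ then wt j (linkRel D (coreCompl v S i ζ)) else 0 := by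
    intro j
    have e : InClassX D (faceVertex v (i + 1)) (faceVertex v (i + 2)) (coreEnd v S i) j (coreCompl v S i ζ) ↔ j = j₀ := hcls j
    by_cases h : j = j₀
    · rw [if_pos (e.2 h), if_pos h]
    · rw [if_neg (fun h' => h (e.1 h')), if_neg h]
  simp only [this, Finset.sum_ite_eq', Finset.mem_univ, ↓reduceIte]

/-- **every core triple contributes zero** under the tripod law. [cite: KhristoforovSmirnov2021, §2 Lemma 4 (p. 4), proof and Fig. 3] -/
theorem core_vanishW {wt : Fin nm → Finset (Fin nm × Fin nm) → ℂ} (hR : TripodLaw wt) {v : HexVertex} (hv : AllSides D v)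
    {S : Finset (Fin 3)} {ζ : Finset (Sym2 (Site 2))} (hq : IsCoreb D v S ζ) :
    ∑ i : Fin 3, tau ^ (i : ℕ) * GkW (D := D) wt v i (coreEnd v S i) (coreCompl v S i ζ) = 0 := by
  classical
  by_cases hinv : S.card = 1 ∨ ∃ i ∈ S, ∃ i' ∈ S, i ≠ i' ∧ XiLinked ζ (oppFace v i) (oppFace v i')
  · -- invariant triple: same class and same link relation at the three edges
    obtain ⟨j₀, hj₀, -⟩ := hbK_complClass_existsUnique hv hq (0 : Fin 3)
    have hcls := invariantTriplesX_holds D v hv S ζ hq hinv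
    have hG : ∀ i : Fin 3, GkW (D := D) wt v i (coreEnd v S i) (coreCompl v S i ζ) = wt j₀ (linkRel D ζ) := fun i => by
      rw [gkW_compl_eq wt hv hq i ((hcls i 0 j₀).2 hj₀), linkRel_coreCompl_of_inv hv hq hinv i]
    simp only [hG, ← Finset.sum_mul]
    rw [Fin.sum_univ_three]
    simp only [Fin.val_zero, Fin.val_one, Fin.val_two, pow_zero, pow_one]
    linear_combination (wt j₀ (linkRel D ζ)) * tau_sum'
  · -- re-linking triple
    have hcard : ¬ S.card = 1 := fun h => hinv (Or.inl h)
    have hnolink : ∀ i ∈ S, ∀ i' ∈ S, i ≠ i' → ¬ XiLinked ζ (oppFace v i) (oppFace v i') :=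
      fun i hi i' hi' hne hl => hinv (Or.inr ⟨i, hi, i', hi', hne, hl⟩)
    have hS : S = Finset.univ := by
      have hle : S.card ≤ 3 := by simpa using Finset.card_le_univ S
      obtain ⟨m, hm⟩ := hq.2.1
      apply Finset.eq_univ_of_card
      simp only [Fintype.card_fin]
      omega
    subst hS
    have hnl : ∀ i i' : Fin 3, i ≠ i' → ¬ XiLinked ζ (oppFace v i) (oppFace v i') :=
      fun i i' hii' => hnolink i (Finset.mem_univ _) i' (Finset.mem_univ _) hii'
    choose p hp using hbK_core_partners hv hq hnl
    -- the class of the completion at `i` is `p i`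
    have hcls : ∀ i : Fin 3, ComplClassX D v Finset.univ i ζ (p i) := by
      intro i
      unfold ComplClassX
      rw [hbK_inClassX_iff]
      refine ⟨hbK_compl_mem hv i _ ζ hq, ?_⟩
      have hend : coreEnd v Finset.univ i = oppFace v i := by unfold coreEnd; rw [if_pos (Finset.mem_univ i)]
      rw [hend]
      exact (xiLinked_iff_reachable _ _ _).1 (xiLinked_mono (by unfold coreCompl; exact Finset.subset_union_left) (hp i))
    have hG : ∀ i : Fin 3, GkW (D := D) wt v i (coreEnd v Finset.univ i) (coreCompl v Finset.univ i ζ) =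
        wt (p i) (withPair (linkRel D ζ) (p (i + 1)) (p (i + 2))) := fun i => by
      rw [gkW_compl_eq wt hv hq i (hcls i), linkRel_coreCompl_relink hv hq hnl hp i]
    simp only [hG]
    rw [Fin.sum_univ_three]
    simp only [Fin.val_zero, Fin.val_one, Fin.val_two, pow_zero, pow_one, one_mul]
    have e11 : (1 : Fin 3) + 1 = 2 := rfl
    have e12 : (1 : Fin 3) + 2 = 0 := rfl
    have e21 : (2 : Fin 3) + 1 = 0 := rfl
    have e22 : (2 : Fin 3) + 2 = 1 := rfl
    have e01 : (0 : Fin 3) + 1 = 1 := rfl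
    have e02 : (0 : Fin 3) + 2 = 2 := rfl
    rw [e11, e12, e21, e22, e01, e02]
    exact hR (p 0) (p 1) (p 2) (linkRel D ζ) (tripodPicture_of_core hv hq hnl hp)

open Classical in
/-- ★★★ **DISCRETE HOLOMORPHICITY FOR EVERY NUMBER OF MARKS**: a class weight satisfying the TRIPOD LAW on every tripod picture gives a
discretely holomorphic observable — `Σ_{i : Fin 3} τ^i ObsW wt v i = 0` at every face with three `H_G`-sides of every `k`-marked domain
(Khristoforov–Smirnov's grouping in triples: the cores of the tree regroup the three XOR spaces at `v`; invariant triples weigh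
`(1 + τ + τ²)·w = 0`; re-linking triples weigh the tripod relation of their — anticlockwise, perfect, planar — picture).
[cite: KhristoforovSmirnov2021, §2 Lemma 4 (p. 4) with its proof and Fig. 3; §1.2 (p. 2)] -/
theorem holomorphicW_of_tripodLaw (D : TriMarkedDomain nm) {wt : Fin nm → Finset (Fin nm × Fin nm) → ℂ} (hR : TripodLaw wt) :
    HolomorphicW D wt := by
  intro v hv
  have step : ∀ i : Fin 3, tau ^ (i : ℕ) * ObsW D wt v i =
      ∑ q ∈ coreSetb D v, tau ^ (i : ℕ) * GkW (D := D) wt v i (coreEnd v q.1 i) (coreCompl v q.1 i q.2) := by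
    intro i
    unfold ObsW
    rw [hbK_regroup hv i (fun s ξ => GkW (D := D) wt v i s ξ), Finset.mul_sum]
  simp only [step]
  rw [Finset.sum_comm]
  refine Finset.sum_eq_zero fun q hq => ?_
  have hq' : IsCoreb D v q.1 q.2 := by
    unfold coreSetb at hq
    exact (Finset.mem_filter.1 hq).2
  exact core_vanishW hR hv hq'

end Assembly

/-! ### `k = 3`: the tripod law for `wt j = τ^j` and Khristoforov–Smirnov's Lemma 4 -/

section ThreeAgain

/-- at three marks the tripod law holds for the weight `j ↦ τ^j` (pictures are rotations of `(0, 1, 2)`; `τ^d (1 + τ² + τ⁴) = 0`).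
[cite: KhristoforovSmirnov2021, §2 Lemma 4 (p. 4), proof] -/
theorem tripodLaw_tau_pow : TripodLaw (nm := 3) (fun j _ => tau ^ (j : ℕ)) := by
  intro α β γ L₀ hP
  obtain ⟨d, hd⟩ := (ccwTriple_iff_rotation ![α, β, γ]).1 hP.ccw
  have h0 : α = 0 + d := hd 0
  have h1 : β = 1 + d := hd 1
  have h2 : γ = 2 + d := hd 2
  have h3 : ∀ d : Fin 3, d = 0 ∨ d = 1 ∨ d = 2 := by decide
  have ht := tau_sum'
  have ht3 : tau ^ 3 = 1 := by linear_combination (tau - 1) * tau_sum'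
  rcases h3 d with rfl | rfl | rfl
  · rw [h0, h1, h2]
    simp only [show ((0 : Fin 3) + 0 : Fin 3) = 0 from rfl, show ((1 : Fin 3) + 0 : Fin 3) = 1 from rfl,
      show ((2 : Fin 3) + 0 : Fin 3) = 2 from rfl, Fin.val_zero, Fin.val_one, Fin.val_two, pow_zero, pow_one]
    linear_combination ht + tau * ht3
  · rw [h0, h1, h2]
    simp only [show ((0 : Fin 3) + 1 : Fin 3) = 1 from rfl, show ((1 : Fin 3) + 1 : Fin 3) = 2 from rfl,
      show ((2 : Fin 3) + 1 : Fin 3) = 0 from rfl, Fin.val_zero, Fin.val_one, Fin.val_two, pow_zero, pow_one, mul_one]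
    linear_combination ht + ht3
  · rw [h0, h1, h2]
    simp only [show ((0 : Fin 3) + 2 : Fin 3) = 2 from rfl, show ((1 : Fin 3) + 2 : Fin 3) = 0 from rfl,
      show ((2 : Fin 3) + 2 : Fin 3) = 1 from rfl, Fin.val_zero, Fin.val_one, Fin.val_two, pow_zero, pow_one, mul_one]
    linear_combination ht + ht3
/-- at three marks, `ObsW (τ^j)` is `Σ_j τ^j N_j(z)`. [cite: KhristoforovSmirnov2021, §2 Definition 3 (p. 4)] -/
theorem obsW_tau_pow_eq (D : TriMarkedDomain 3) (v : HexVertex) (i : Fin 3) :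
    ObsW D (fun j _ => tau ^ (j : ℕ)) v i = ∑ j : Fin 3, tau ^ (j : ℕ) * (classCount D v i j : ℂ) := by
  rw [sum_tau_classCount_eq]
  unfold ObsW GkW Gk
  rfl

/-- **Khristoforov–Smirnov's Lemma 4 (`k = 3`) re-derived from the generic theorem.** [cite: KhristoforovSmirnov2021, §2 Lemma 4 (p. 4)] -/
theorem khsLemma4_of_tripodLaw (D : TriMarkedDomain 3) : KhSLemma4 D := by
  intro v hv
  have h := holomorphicW_of_tripodLaw D tripodLaw_tau_pow v hv
  simp only [obsW_tau_pow_eq] at h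
  have h2G : (2 : ℂ) ^ #D.verts ≠ 0 := pow_ne_zero _ two_ne_zero
  have hF : ∀ i : Fin 3, Fobs D v i = (∑ j : Fin 3, tau ^ (j : ℕ) * (classCount D v i j : ℂ)) / 2 ^ #D.verts := by
    intro i
    unfold Fobs Hobs
    rw [Finset.sum_div]
    refine Finset.sum_congr rfl fun j _ => ?_
    push_cast
    ring
  have hsum : ∑ i : Fin 3, tau ^ (i : ℕ) * Fobs D v i =
      (∑ i : Fin 3, tau ^ (i : ℕ) * ∑ j : Fin 3, tau ^ (j : ℕ) * (classCount D v i j : ℂ)) / 2 ^ #D.verts := by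
    rw [Finset.sum_div]
    refine Finset.sum_congr rfl fun i _ => ?_
    rw [hF i]
    ring
  rw [hsum, h, zero_div]

/-- `KhSLemma4` holds for all parameters — `_holds` alias of `khsLemma4_of_tripodLaw` above under the fact's exact name
(appended 2026-08-28, D-0026 bookkeeping: the proof term is the existing theorem of this file; no statement,
definition or attribute is edited; no new named fact; the ledger's debt table listed the fact
unproved). [cite: KhristoforovSmirnov2021, §2 Lemma 4 (p. 4)] -/
theorem _root_.Literature.Probability.Percolation.MarkedLoops.KhSLemma4_holds
    (D : TriMarkedDomain 3) :
    KhSLemma4 D :=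
  _root_.Literature.Probability.Percolation.MarkedLoops.khsLemma4_of_tripodLaw D

end ThreeAgain


/-! # Part IV — AN EXPLICIT SOLUTION OF THE TRIPOD LAW FOR EVERY ODD NUMBER OF MARKS: the FAN observable

For `k = 2l + 1` marks (corners `0, …, 2l` anticlockwise) and `0 ≤ m ≤ l`, the FAN PATTERN `P_m` is: partner `m`, and the other
corners matched as `{i, 2l − i}` for `i < m` and `{i, 2l + 1 − i}` for `m < i ≤ l` (two nested rainbows meeting at the partner). The FAN
WEIGHT gives `P_m` the weight `−(−τ²)^m` and every other pattern the weight `0` (`fanWt`). THEOREM `tripodLaw_fan`: the fan weight obeys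
the tripod law — the only tripod pictures meeting its support are `(m, m+1, 2l−m; P_m ∖ {m+1, 2l−m})`, on which the law reads
`c_m + τ·c_{m+1} = 0`; all other candidate pictures are excluded by PLANARITY or by the anticlockwise order. Hence (`holomorphicW_fan`)
the `(l+1)`-term fan observable is discretely holomorphic on EVERY `(2l+1)`-marked domain: at `k = 3` it is `−N_0 1[12] + τ² N_1 1[02]`
(in the span of Khristoforov–Smirnov's `F` and the constant), at `k = 5` it is the lane's sparse five-point observable (up to the factor
`−τ²`), and for `k ≥ 7` it is new. -/

section Fan

variable (l : ℕ)

open Classical in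
/-- **the fan relation with apex `m`** on `Fin (2l+1)`: the pairs `{i, 2l−i}` (`i < m`) and `{i, 2l+1−i}` (`m < i ≤ l`), both orientations.
[cite: KhristoforovSmirnov2021, §1.2 (arXiv v1 p. 2: the link pattern); §2 Definition 3 (p. 4)] -/
def fanRel (m : ℕ) : Finset (Fin (2 * l + 1) × Fin (2 * l + 1)) :=
  Finset.univ.filter fun ab =>
    (ab.1.val + ab.2.val = 2 * l ∧ (ab.1.val < m ∨ ab.2.val < m)) ∨
    (ab.1.val + ab.2.val = 2 * l + 1 ∧ ((m < ab.1.val ∧ ab.1.val ≤ l) ∨ (m < ab.2.val ∧ ab.2.val ≤ l)))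

open Classical in
/-- **the FAN WEIGHT** for `2l+1` marks: `−(−τ²)^m` on the fan pattern with apex `m ≤ l`, zero elsewhere.
[cite: KhristoforovSmirnov2021, §2 Definition 3 (p. 4: `H(ξ) = Σ_j τ^j 1_{z↔u_j}`, the case `k = 3`)] -/
noncomputable def fanWt (j : Fin (2 * l + 1)) (L : Finset (Fin (2 * l + 1) × Fin (2 * l + 1))) : ℂ :=
  if j.val ≤ l ∧ L = fanRel l j.val then -((-tau ^ 2) ^ j.val) else 0

variable {l}

/-- membership in the fan relation. [cite: KhristoforovSmirnov2021, §1.2 (arXiv v1 p. 2)] -/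
theorem mem_fanRel {m : ℕ} {a b : Fin (2 * l + 1)} :
    (a, b) ∈ fanRel l m ↔ (a.val + b.val = 2 * l ∧ (a.val < m ∨ b.val < m)) ∨
      (a.val + b.val = 2 * l + 1 ∧ ((m < a.val ∧ a.val ≤ l) ∨ (m < b.val ∧ b.val ≤ l))) := by
  unfold fanRel
  rw [Finset.mem_filter]
  exact ⟨fun h => h.2, fun h => ⟨Finset.mem_univ _, h⟩⟩

/-- the fan weight off its support. [cite: KhristoforovSmirnov2021, §2 Definition 3 (p. 4)] -/
theorem fanWt_eq_zero_of_lt {j : Fin (2 * l + 1)} (hj : l < j.val) (L : Finset (Fin (2 * l + 1) × Fin (2 * l + 1))) :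
    fanWt l j L = 0 := by
  unfold fanWt
  rw [if_neg (fun h => absurd h.1 (not_le.2 hj))]

/-- the fan weight on its support. [cite: KhristoforovSmirnov2021, §2 Definition 3 (p. 4)] -/
theorem fanWt_eq_of_eq {j : Fin (2 * l + 1)} (hj : j.val ≤ l) {L : Finset (Fin (2 * l + 1) × Fin (2 * l + 1))} (hL : L = fanRel l j.val) :
    fanWt l j L = -((-tau ^ 2) ^ j.val) := by
  unfold fanWt
  rw [if_pos ⟨hj, hL⟩]

/-- a nonzero fan weight sits on the support. [cite: KhristoforovSmirnov2021, §2 Definition 3 (p. 4)] -/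
theorem fanWt_ne_zero_iff {j : Fin (2 * l + 1)} {L : Finset (Fin (2 * l + 1) × Fin (2 * l + 1))} (h : fanWt l j L ≠ 0) :
    j.val ≤ l ∧ L = fanRel l j.val := by
  unfold fanWt at h
  by_contra hc
  exact h (if_neg hc)

end Fan

section FanLaw

variable {nm : ℕ}

/-- the chords of a tripod picture: membership. [folklore] -/
private theorem mem_chords {α β γ : Fin nm} {L₀ : Finset (Fin nm × Fin nm)} {x z : Fin nm} :
    (x, z) ∈ withPair (withPair (withPair L₀ α β) β γ) γ α ↔
      (x = γ ∧ z = α) ∨ (x = α ∧ z = γ) ∨ (x = β ∧ z = γ) ∨ (x = γ ∧ z = β) ∨ (x = α ∧ z = β) ∨ (x = β ∧ z = α) ∨ (x, z) ∈ L₀ := by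
  rw [mem_withPair, mem_withPair, mem_withPair]

/-- **tripod pictures rotate**: `(α, β, γ; L₀) ↦ (β, γ, α; L₀)`. [cite: KhristoforovSmirnov2021, §2 Lemma 4, proof and Fig. 3 (p. 4)] -/
theorem TripodPicture.rotate {α β γ : Fin nm} {L₀ : Finset (Fin nm × Fin nm)} (h : TripodPicture α β γ L₀) :
    TripodPicture β γ α L₀ := by
  refine ⟨?_, h.symm, h.irrefl, fun a b hab => ?_, fun a ha hb hc => h.perfect a hc ha hb, fun x y z w hxz hyw => ?_⟩
  · have hc := h.ccw
    unfold CcwTriple at hc ⊢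
    tauto
  · obtain ⟨h1, h2, h3⟩ := h.off a b hab
    exact ⟨h2, h3, h1⟩
  · refine h.planar x y z w ?_ hyw
    rw [mem_chords] at hxz ⊢
    tauto

variable {l : ℕ}

/-- an anticlockwise triple starting at its smallest element is increasing. [folklore] -/
private theorem ccw_lt_of_lt {a b c : Fin (2 * l + 1)} (h : CcwTriple a b c) (hac : a < c) : b < c := by
  unfold CcwTriple at h
  rcases h with ⟨-, h2⟩ | ⟨-, h2⟩ | ⟨h1, -⟩
  · exact h2
  · exact absurd hac (lt_asymm h2)
  · exact absurd hac (lt_asymm h1)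

/-- ★ **the FAN LAW, main case**: a tripod picture whose first pattern is a fan pattern satisfies the tripod relation for the fan weight
(planarity pins the chord `{β, γ}` of the apex to one of the two chords adjacent to it; then exactly one other term is a fan weight and the
two cancel: `c_m + τ c_{m+1} = 0`, resp. `c_m + τ² c_{m−1} = −(−τ²)^{m−1}(−τ² + τ²) = 0`).
[cite: KhristoforovSmirnov2021, §2 Lemma 4, proof and Fig. 3 (p. 4: «each triple contributes zero»)] -/
theorem fan_main {α β γ : Fin (2 * l + 1)} {L₀ : Finset (Fin (2 * l + 1) × Fin (2 * l + 1))} (hP : TripodPicture α β γ L₀)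
    (h1 : fanWt l α (withPair L₀ β γ) ≠ 0) :
    fanWt l α (withPair L₀ β γ) + tau * fanWt l β (withPair L₀ γ α) + tau ^ 2 * fanWt l γ (withPair L₀ α β) = 0 := by
  obtain ⟨hm, hF⟩ := fanWt_ne_zero_iff h1
  set m := α.val with hm_def
  have hα : α.val = m := rfl
  have ht3 : tau ^ 3 = 1 := by linear_combination (tau - 1) * tau_sum'
  -- distinctness from the anticlockwise order
  have hccw := hP.ccw
  have hαβ : α ≠ β := by
    intro e; rw [e] at hccw; unfold CcwTriple at hccw
    rcases hccw with ⟨h, -⟩ | ⟨h, h'⟩ | ⟨-, h⟩ <;> first | exact lt_irrefl _ h | exact lt_irrefl _ (h.trans h')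
  have hαγ : α ≠ γ := by
    intro e; rw [e] at hccw; unfold CcwTriple at hccw
    rcases hccw with ⟨h, h'⟩ | ⟨-, h⟩ | ⟨h, -⟩ <;> first | exact lt_irrefl _ h | exact lt_irrefl _ (h.trans h')
  have hβγ : β ≠ γ := by
    intro e; rw [e] at hccw; unfold CcwTriple at hccw
    rcases hccw with ⟨-, h⟩ | ⟨h, -⟩ | ⟨h, h'⟩ <;> first | exact lt_irrefl _ h | exact lt_irrefl _ (h.trans h')
  -- `L₀` = the fan relation minus the chord `{β, γ}`
  have hL₀ : ∀ a b : Fin (2 * l + 1), (a, b) ∈ L₀ ↔ ((a, b) ∈ fanRel l m ∧ ¬ (a = β ∧ b = γ) ∧ ¬ (a = γ ∧ b = β)) := by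
    intro a b
    constructor
    · intro h
      obtain ⟨-, h2, h3⟩ := hP.off a b h
      refine ⟨?_, fun e => h2 e.1, fun e => h3 e.1⟩
      rw [← hF, mem_withPair]; exact Or.inr (Or.inr h)
    · rintro ⟨h, n1, n2⟩
      rw [← hF, mem_withPair] at h
      rcases h with h | h | h
      · exact absurd h n1
      · exact absurd h n2
      · exact h
  -- the chord `{β, γ}` is a pair of the fan
  have hβγF : (β, γ) ∈ fanRel l m := by rw [← hF, mem_withPair]; exact Or.inl ⟨rfl, rfl⟩
  rw [mem_fanRel] at hβγF
  -- tripod chords are chords of the picture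
  have chordαβ : (α, β) ∈ withPair (withPair (withPair L₀ α β) β γ) γ α := by rw [mem_chords]; tauto
  have chordγα : (γ, α) ∈ withPair (withPair (withPair L₀ α β) β γ) γ α := by rw [mem_chords]; tauto
  have hbl := β.isLt
  have hgl := γ.isLt
  have hal := α.isLt
  -- value bookkeeping for `Fin` equalities
  have vext : ∀ {x y : Fin (2 * l + 1)}, x = y ↔ x.val = y.val := fun {x y} => Fin.ext_iff
  rcases hβγF with ⟨hsum, hlt | hlt⟩ | ⟨hsum, ⟨hlt1, hlt2⟩ | ⟨hlt1, hlt2⟩⟩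
  · -- A-type with `β < m = α`: not anticlockwise
    exfalso
    have hβα : β < α := Fin.lt_def.2 (by omega)
    have hαγ' : α < γ := Fin.lt_def.2 (by omega)
    unfold CcwTriple at hccw
    rcases hccw with ⟨h, -⟩ | ⟨-, h⟩ | ⟨h, -⟩
    · exact lt_asymm h hβα
    · exact lt_asymm h hαγ'
    · exact lt_asymm h hαγ'
  · -- A-type with `γ < m`: the outer chord `{m−1, 2l+1−m}` — planarity forces `γ = m − 1`
    have hγm : γ.val = m - 1 := by
      by_contra hne
      have hγ2 : γ.val + 2 ≤ m := by omega
      -- the chord (m−1, 2l+1−m) of the fan lies in `L₀` and crosses the tripod chord (γ, α)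
      have q1 : m - 1 < 2 * l + 1 := by omega
      have q2 : 2 * l + 1 - m < 2 * l + 1 := by omega
      have hq : ((⟨m - 1, q1⟩ : Fin (2 * l + 1)), (⟨2 * l + 1 - m, q2⟩ : Fin (2 * l + 1))) ∈ L₀ := by
        rw [hL₀, mem_fanRel, vext, vext, vext, vext]
        refine ⟨Or.inl ⟨by simp only; omega, Or.inl (by simp only; omega)⟩, ?_, ?_⟩ <;> simp only <;> omega
      refine absurd ?_ (hP.planar γ ⟨m - 1, q1⟩ α ⟨2 * l + 1 - m, q2⟩ chordγα hq)
      unfold CcwQuad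
      left
      refine ⟨Fin.lt_def.2 (by simp only; omega), Fin.lt_def.2 (by simp only; omega),
        Fin.lt_def.2 (by simp only; omega)⟩
    have hm1 : 1 ≤ m := by omega
    have hβv : β.val = 2 * l + 1 - m := by omega
    -- the third pattern is the fan pattern with apex `m − 1`; the second has apex value `> l`
    have hT2 : fanWt l β (withPair L₀ γ α) = 0 := fanWt_eq_zero_of_lt (by omega) _
    have hT3 : fanWt l γ (withPair L₀ α β) = -((-tau ^ 2) ^ (m - 1)) := by
      rw [← hγm]
      refine fanWt_eq_of_eq (by omega) ?_
      rw [hγm]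
      ext ⟨a, b⟩
      rw [mem_withPair, hL₀, mem_fanRel, mem_fanRel]
      simp only [Fin.ext_iff]
      have ha := a.isLt; have hb := b.isLt
      constructor
      · rintro (⟨h1, h2⟩ | ⟨h1, h2⟩ | ⟨h1, h2, h3⟩) <;> omega
      · intro h
        by_cases e1 : a.val = α.val ∧ b.val = β.val
        · exact Or.inl e1
        by_cases e2 : a.val = β.val ∧ b.val = α.val
        · exact Or.inr (Or.inl e2)
        refine Or.inr (Or.inr ⟨?_, ?_, ?_⟩) <;> omega
    have hT1 : fanWt l α (withPair L₀ β γ) = -((-tau ^ 2) ^ m) := fanWt_eq_of_eq hm hF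
    rw [hT1, hT2, hT3]
    obtain ⟨m', hm'⟩ : ∃ m', m = m' + 1 := ⟨m - 1, by omega⟩
    rw [hm', Nat.add_sub_cancel]
    ring
  · -- B-type with `m < β ≤ l`: the inner chord `{m+1, 2l−m}` — planarity forces `β = m + 1`
    have hβm : β.val = m + 1 := by
      by_contra hne
      have hβ2 : m + 2 ≤ β.val := by omega
      have q1 : m + 1 < 2 * l + 1 := by omega
      have q2 : 2 * l - m < 2 * l + 1 := by omega
      have hq : ((⟨m + 1, q1⟩ : Fin (2 * l + 1)), (⟨2 * l - m, q2⟩ : Fin (2 * l + 1))) ∈ L₀ := by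
        rw [hL₀, mem_fanRel, vext, vext, vext, vext]
        refine ⟨Or.inr ⟨by simp only; omega, Or.inl ⟨by simp only; omega, by simp only; omega⟩⟩, ?_, ?_⟩ <;> simp only <;> omega
      refine absurd ?_ (hP.planar α ⟨m + 1, q1⟩ β ⟨2 * l - m, q2⟩ chordαβ hq)
      unfold CcwQuad
      left
      refine ⟨Fin.lt_def.2 (by simp only; omega), Fin.lt_def.2 (by simp only; omega),
        Fin.lt_def.2 (by simp only; omega)⟩
    have hml : m < l := by omega
    have hγv : γ.val = 2 * l - m := by omega
    have hT2 : fanWt l β (withPair L₀ γ α) = -((-tau ^ 2) ^ (m + 1)) := by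
      rw [← hβm]
      refine fanWt_eq_of_eq (by omega) ?_
      rw [hβm]
      ext ⟨a, b⟩
      rw [mem_withPair, hL₀, mem_fanRel, mem_fanRel]
      simp only [Fin.ext_iff]
      have ha := a.isLt; have hb := b.isLt
      constructor
      · rintro (⟨h1, h2⟩ | ⟨h1, h2⟩ | ⟨h1, h2, h3⟩) <;> omega
      · intro h
        by_cases e1 : a.val = γ.val ∧ b.val = α.val
        · exact Or.inl e1
        by_cases e2 : a.val = α.val ∧ b.val = γ.val
        · exact Or.inr (Or.inl e2)
        refine Or.inr (Or.inr ⟨?_, ?_, ?_⟩) <;> omega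
    have hT3 : fanWt l γ (withPair L₀ α β) = 0 := fanWt_eq_zero_of_lt (by omega) _
    have hT1 : fanWt l α (withPair L₀ β γ) = -((-tau ^ 2) ^ m) := fanWt_eq_of_eq hm hF
    rw [hT1, hT2, hT3]
    linear_combination ((-tau ^ 2) ^ m) * ht3
  · -- B-type with `m < γ ≤ l < β`: not anticlockwise
    exfalso
    have hαγ' : α < γ := Fin.lt_def.2 (by omega)
    have hγβ : γ < β := Fin.lt_def.2 (by omega)
    exact lt_asymm (ccw_lt_of_lt hccw hαγ') hγβ

/-- ★★ **THE FAN WEIGHT OBEYS THE TRIPOD LAW** (every odd number of marks). [cite: KhristoforovSmirnov2021, §2 Lemma 4, proof and Fig. 3 (p. 4)] -/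
theorem tripodLaw_fan (l : ℕ) : TripodLaw (nm := 2 * l + 1) (fanWt l) := by
  intro α β γ L₀ hP
  by_cases h1 : fanWt l α (withPair L₀ β γ) = 0
  · by_cases h2 : fanWt l β (withPair L₀ γ α) = 0
    · by_cases h3 : fanWt l γ (withPair L₀ α β) = 0
      · rw [h1, h2, h3]; ring
      · have key := fan_main hP.rotate.rotate h3
        rw [h1, h2] at key ⊢
        linear_combination tau ^ 2 * key
    · have key := fan_main hP.rotate h2
      rw [h1] at key ⊢
      linear_combination tau * key
  · exact fan_main hP h1

/-- ★★★ **THE FAN OBSERVABLE IS DISCRETELY HOLOMORPHIC FOR EVERY ODD NUMBER OF MARKS**: on every `(2l+1)`-marked discrete domain and at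
every face with three `H_G`-sides, `Σ_{i : Fin 3} τ^i ObsW (fanWt l) v i = 0`, where the fan observable weighs a configuration by
`−(−τ²)^m` if the mid-edge `z` is linked to the corner `u_m` (`m ≤ l`) and the other corners are linked as the fan `P_m`, and by `0`
otherwise — an explicit `(l+1)`-term parafermionic observable with `2l + 1` boundary disorders (at `k = 3` in the span of
Khristoforov–Smirnov's `F` and `1`; at `k = 5` the lane's sparse observable). [cite: KhristoforovSmirnov2021, §2 Definition 3 and Lemma 4 (p. 4); §1 (p. 1: «immediate generalizations»)] -/
theorem holomorphicW_fan (l : ℕ) (D : TriMarkedDomain (2 * l + 1)) : HolomorphicW D (fanWt l) :=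
  holomorphicW_of_tripodLaw D (tripodLaw_fan l)

end FanLaw

end Literature.Probability.Percolation.MarkedLoops
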